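import Literature.Probability.RandomPlanarGeometry.HexSAWRotTriangleIdentity
import Literature.Probability.RandomPlanarGeometry.HexParafermionWeighted
import HarnessLib

/-!
# Beaton 2014 Prop. 6 at `n = 0`: the rotated strip identity WITH A SURFACE FUGACITY `y` on the top row

Topic `Literature/Probability/RandomPlanarGeometry` (continues `HexSAWRotStripClasses.lean` — the exit classes of `D(H,W)`,
their windings and boundary terms, `rotGF`, Prop. 4 = `rotStrip_identity` — and `HexParafermionWeighted.lean` — the vertex
relation with a surface weight `swt S y`, `boundary_sum_weighted`; lane «pcv-sawmu», door R96 «BEATON-YC» of the successor plan,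
face K96.1 «ROT-STRIP-IDENTITY-Y»).  Source: N. R. Beaton, *The critical surface fugacity of self-avoiding walks on a rotated
honeycomb lattice*, J. Phys. A 47 (2014) 075003 (arXiv:1210.0274v3), §2.4 and Proposition 6 (arXiv v3 p. 9; parity hypothesis
`T + L ≡ 1 (mod 2)`; `n = 0` branch `x_c^{-1} = 2cos(π/8)`), proof pp. 9–10 (`Γ¹`, `Γ²`, `Γ² = x y Γ¹`, `B = 2(xy + x²y²)Γ¹`).

## What is proved (HOME build of a-p2 g7, 2026-08-23; all statements sorry-free, standard axioms)

Label (lane lit-1): CONSOLIDATION — printed identity (Prop. 6 at `n = 0`) with printed proof, up to ONE step: Beaton closes the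
top-row defect by the reflection in the vertical axis (`Γ² = x y Γ¹` for both-starts sums); for the tree's RIGHT-started walks
the same relation is proved here by the ROW-DIMER BIJECTION `γ ↦ γ ++ [r(v)]` (for `H + W` odd the top row of `D(H, W)` is a
union of uncut `Δξ = 0` dimers, `xiSide_mem_rotStripV`; a first arrival from below has not visited the partner,
`xiSide_notMem_of_arrBelow`), which is what makes the right-started half provable without left-started walks.  The parity
hypothesis `Odd (H + Wd)` is Beaton's «`T + L ≡ 1 (mod 2)`»; on finite data the identity FAILS for `H + W` even (lane y-table).

* `topContacts H P` (`c(γ)`), `rotGFy V H cls y` (`Σ x_c^ℓ y^c`; `rotGFy_one`), `rotTop`, `swt_rotTop`;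
* `boundary_sum_rotY`, `boundary_sum_rotY_re`, `classSum_rotY` — the exits sorted into Beaton's classes with the `y`-weight
  riding along (the class boundary terms of `HexSAWRotStripClasses` are `y`-independent), defect `(1 - y) Re[𝔇 e^{-3πi/16}/e₀]`;
* the first arrivals at the top row: `xiSide` (row partner), `arrBelow` (`Γ¹`), `arrRow` (`Γ²`), `rotG1`, `rotG2`,
  `defect_eq_sum_arrivals`, `hopf_arrival` (Hopf with `c₁ = c₂ = -I` at a highest point), **`pturn_of_arrBelow`** (`2/1`),
  **`pturn_of_arrRow`** (`0/3`), `arrTerm_re_of_arrBelow` (`-cos(π/16)`), `arrTerm_re_of_arrRow` (`-cos(3π/16)`), **`defect_re`**;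
* **`rotGFy_top_eq`** (`B(y) = x_c y (G¹ + G²)`: drop/append the step out), **`rotG2_eq`** (`G² = x_c y G¹`, `H + W` odd),
  `rotGFy_top_eq_G1` (`B = x_c y (1 + x_c y) G¹`);
* **`rotStrip_identityY_master`** (division-free, every real `y`), `beaton_coeff_eq`, **`rotStrip_identityY`** — Proposition 6 at
  `n = 0` with the printed bracket `cos(π/16) - ((1 - x_c y - x_c²y²)cos(17π/16) + x_c²y² cos(5π/16))/(x_c y(1 + x_c y))`;
* Beaton's §4 shorthand: `rotB_coeff_eq` (`= (cos(π/16) - x_c²y² cos(5π/16))/(x_c y (1 + x_c y))`), `rotYdagger`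
  (`y† = √(cos(π/16)/cos(5π/16))/x_c`), `rotYdagger_eq_printed` (`= √((2+√2)/(1+√2-√(2+√2)))`), `rotB_coeff_pos_iff`
  (sign and root), `rotGFy_nonneg`, `rotGFy_mono`, **`rotGFy_top_le_of_odd`**, **`rotGFy_top_le`** — the finiteness of
  `B_{H,W}(x_c, y)` for `0 < y < y†`, uniformly in `H, W` (the input of Beaton's Lemma 12, `y_c ≥ y†`).
  `rotGFy_top_monotone`, **`rotGFy_top_tendsto`** (`B_T(x_c,y) = lim_W B_{H,W}(x_c,y)` exists, finite, for `0 < y < y†`).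
NOT here: the definition of `y_c` and Beaton's Prop. 7 / Prop. 11 / Lemma 12 / Theorem 1 themselves.
-/

noncomputable section

namespace Literature.Probability.RandomPlanarGeometry.SAW

namespace HV

open Finset Real Complex

/-! ### Surface contacts on the top row of `D(H, W)` and the weighted class generating functions -/

/-- **Beaton's `c(γ)` for the rotated strip**: the number of (inner) vertices of the walk in the top row `ξ = -H` (the `β`
vertices, which carry the fugacity `y`). [cite: Beaton2014RotatedHoneycomb, §2.4 ("we associate the surface fugacity y with vertices on the β boundary of D_{T,L}")] -/
def topContacts (H : ℕ) (P : List HV) : ℕ := (inner P).countP (fun v => xi v = -(H : ℤ))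

/-- The right-started class generating function with surface fugacity: `Σ_{γ : finalDart ∈ cls} x_c^{ℓ(γ)} y^{c(γ)}`.
[cite: Beaton2014RotatedHoneycomb, §2.4 (A^O_{T,L}(x,y;n) = Σ x^{|γ|} n^{ℓ(γ)} y^{c(γ)}, arXiv v3 p. 8)] -/
def rotGFy (V : Finset HV) (H : ℕ) (cls : HV × HV → Prop) [DecidablePred cls] (y : ℝ) : ℝ :=
  ∑ P ∈ (midWalks V).filter (fun P => cls (finalDart P)), hexCriticalFugacity ^ mwLen P * y ^ topContacts H P

/-- At `y = 1` the weighted generating function is `rotGF`. [cite: Beaton2014RotatedHoneycomb, §2.4] -/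
theorem rotGFy_one (V : Finset HV) (H : ℕ) (cls : HV × HV → Prop) [DecidablePred cls] : rotGFy V H cls 1 = rotGF V cls := by
  simp [rotGFy, rotGF]

/-- The surface set: the top row of `D(H, W)`. [cite: Beaton2014RotatedHoneycomb, §2.2 (the β boundary)] -/
def rotTop (H Wd : ℕ) : Finset HV := (rotStripV H Wd).filter (fun v => xi v = -(H : ℤ))

/-- On walks of `D(H,W) ∖ {a⁻}` the generic surface weight of `HexParafermionWeighted` for `S = rotTop H W` is `y^{c(γ)}`.
[cite: Beaton2014RotatedHoneycomb, §2.4] -/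
theorem swt_rotTop {H Wd : ℕ} {P : List HV} (hP : IsMidWalk ((rotStripV H Wd).erase wOut) P) (y : ℝ) :
    swt (rotTop H Wd) (y : ℂ) P = ((y ^ topContacts H P : ℝ) : ℂ) := by
  rw [swt, topContacts, Complex.ofReal_pow]
  congr 1
  refine List.countP_congr fun v hv => ?_
  have hvV : v ∈ rotStripV H Wd := mem_of_mem_erase (hP.2.2.2.1 v hv)
  simp [rotTop, hvV]

/-! ### The weighted boundary sum on `D(H, W) ∖ {a⁻}` -/

/-- **The weighted boundary sum of Beaton's rotated strip** (complex form): with `V = D(H,W) ∖ {a⁻}` and `S` = the top row,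
`Σ_{exits} edir · x_c^ℓ λ^W · y^c = e₀ + (1 - y) Σ_{v ∈ top row} Σ_{γ ∈ clsIn V v} (t - v) x_c^ℓ λ^W y^c`.
[cite: Beaton2014RotatedHoneycomb, §2.4, proof of Proposition 6 (the sum S computed two ways)] -/
theorem boundary_sum_rotY (H Wd : ℕ) (y : ℝ) :
    ∑ P ∈ (midWalks ((rotStripV H Wd).erase wOut)).filter
        (fun P => P ≠ [wOut, hvOrigin] ∧ (finalDart P).2 ∉ (rotStripV H Wd).erase wOut),
      edir (finalDart P).1 (finalDart P).2 * pwt P * swt (rotTop H Wd) (y : ℂ) P =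
    edir wOut hvOrigin + (1 - (y : ℂ)) *
      ∑ v ∈ ((rotStripV H Wd).erase wOut).filter (· ∈ rotTop H Wd),
        ∑ P ∈ clsIn ((rotStripV H Wd).erase wOut) v, edir v (finalDart P).1 * pwt P * swt (rotTop H Wd) (y : ℂ) P := by
  obtain ⟨hw, hO, hξ⟩ := rotStripV_erase_hyps H Wd
  exact boundary_sum_weighted hw (noWinding_of_xi_le hξ) hO _ _

/-- The normalising phase has real part `cos(3π/16)`. [cite: Beaton2014RotatedHoneycomb, Proposition 4 (proof, adjusted winding)] -/
private theorem rotPhase_re : rotPhase.re = Real.cos (3 * π / 16) := by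
  rw [rotPhase, Complex.exp_ofReal_mul_I_re, Real.cos_neg]

/-- `e₀ ≠ 0`. [folklore] -/
private theorem e0_ne_zero' : emb (-1, 2) ≠ 0 := by
  rw [Ne, emb_eq_zero_iff]; simp

/-- **The weighted boundary sum, real normalised form**: `Σ_{exits} x_c^ℓ y^c Re T(γ) = cos(3π/16) + (1 - y) Re[𝔇 · e^{-3πi/16}/e₀]`
with `T(γ) = edir(final) λ^{W}/e₀ · e^{-3πi/16}` and `𝔇` the top-row defect. [cite: Beaton2014RotatedHoneycomb, proof of Proposition 6 ("Multiplying by -2i and rearranging")] -/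
theorem boundary_sum_rotY_re (H Wd : ℕ) (y : ℝ) :
    ∑ P ∈ (midWalks ((rotStripV H Wd).erase wOut)).filter
        (fun P => P ≠ [wOut, hvOrigin] ∧ (finalDart P).2 ∉ (rotStripV H Wd).erase wOut),
      hexCriticalFugacity ^ mwLen P * y ^ topContacts H P *
        (edir (finalDart P).1 (finalDart P).2 * lam ^ pturn P / emb (-1, 2) * rotPhase).re =
    Real.cos (3 * π / 16) + (1 - y) *
      (( ∑ v ∈ ((rotStripV H Wd).erase wOut).filter (· ∈ rotTop H Wd),
          ∑ P ∈ clsIn ((rotStripV H Wd).erase wOut) v,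
            edir v (finalDart P).1 * pwt P * swt (rotTop H Wd) (y : ℂ) P) / emb (-1, 2) * rotPhase).re := by
  have h := boundary_sum_rotY H Wd y
  have e0 : edir wOut hvOrigin = emb (-1, 2) := by rw [edir, pos_hvOrigin, pos_wOut]; rfl
  rw [e0] at h
  have hne := e0_ne_zero'
  set D := ∑ v ∈ ((rotStripV H Wd).erase wOut).filter (· ∈ rotTop H Wd),
      ∑ P ∈ clsIn ((rotStripV H Wd).erase wOut) v, edir v (finalDart P).1 * pwt P * swt (rotTop H Wd) (y : ℂ) P with hD
  have h2 : ∑ P ∈ (midWalks ((rotStripV H Wd).erase wOut)).filter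
      (fun P => P ≠ [wOut, hvOrigin] ∧ (finalDart P).2 ∉ (rotStripV H Wd).erase wOut),
      edir (finalDart P).1 (finalDart P).2 * pwt P * swt (rotTop H Wd) (y : ℂ) P * (rotPhase / emb (-1, 2)) =
      rotPhase + (1 - (y : ℂ)) * (D / emb (-1, 2) * rotPhase) := by
    rw [← Finset.sum_mul, h]; field_simp
  have h3 := congrArg Complex.re h2
  rw [Complex.re_sum, Complex.add_re, rotPhase_re] at h3
  have h4 : ((1 - (y : ℂ)) * (D / emb (-1, 2) * rotPhase)).re = (1 - y) * (D / emb (-1, 2) * rotPhase).re := by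
    rw [show (1 - (y : ℂ)) = ((1 - y : ℝ) : ℂ) by push_cast; ring, Complex.re_ofReal_mul]
  rw [h4] at h3
  rw [← h3]
  refine sum_congr rfl fun P hP => ?_
  have hPw : IsMidWalk ((rotStripV H Wd).erase wOut) P := mem_midWalks_iff.1 (mem_filter.1 hP).1
  rw [swt_rotTop hPw, pwt, show edir (finalDart P).1 (finalDart P).2 * ((hexCriticalFugacity : ℂ) ^ mwLen P * lam ^ pturn P) *
      ((y ^ topContacts H P : ℝ) : ℂ) * (rotPhase / emb (-1, 2)) =
      ((hexCriticalFugacity ^ mwLen P * y ^ topContacts H P : ℝ) : ℂ) *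
        (edir (finalDart P).1 (finalDart P).2 * lam ^ pturn P / emb (-1, 2) * rotPhase) by push_cast; ring,
    Complex.re_ofReal_mul]

/-! ### Sorting the exits into Beaton's classes (the `y`-weight rides along) -/

/-- The weighted class sum: `Σ_P [cls] x_c^ℓ y^c · c_cls = c_cls · rotGFy`. [cite: Beaton2014RotatedHoneycomb, §2.4] -/
theorem sum_ite_class_eq_rotGFy (V : Finset HV) (H : ℕ) (cls : HV × HV → Prop) [DecidablePred cls] (y c : ℝ) :
    ∑ P ∈ midWalks V, (if cls (finalDart P) then hexCriticalFugacity ^ mwLen P * y ^ topContacts H P * c else 0) =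
      c * rotGFy V H cls y := by
  rw [rotGFy, mul_sum, sum_filter]
  refine sum_congr rfl fun P _ => ?_
  split_ifs <;> ring

/-- The stub walk has no surface contact (`H ≥ 1`: its only inner vertex `a⁺` has `ξ = 0`). [cite: Beaton2014RotatedHoneycomb, §2.4] -/
theorem topContacts_stub {H : ℕ} (hH : 1 ≤ H) : topContacts H [wOut, hvOrigin, ((0 : ℤ), (0 : ℤ), true)] = 0 := by
  have : xi hvOrigin ≠ -(H : ℤ) := by rw [xi_hvOrigin]; omega
  simp [topContacts, inner, this]

/-- **The exits of `D(H,W)` sorted into classes, with surface fugacity**: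
`cos(π/16) B(y) + cos(3π/16) E(y) + cos(5π/16) A^O(y) + cos(7π/16) A^I(y) + cos(7π/16) P(y) + x_c cos(5π/16)
  = cos(3π/16) + (1 - y) · Re[𝔇 e^{-3πi/16}/e₀]` (`H, W ≥ 1`). [cite: Beaton2014RotatedHoneycomb, §2.4, proof of Proposition 6 ("The second method for calculating S … does not change from the unweighted case")] -/
theorem classSum_rotY {H Wd : ℕ} (hH : 1 ≤ H) (hW : 1 ≤ Wd) (y : ℝ) :
    Real.cos (π / 16) * rotGFy ((rotStripV H Wd).erase wOut) H (IsRotTopDart H) y +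
      Real.cos (3 * π / 16) * rotGFy ((rotStripV H Wd).erase wOut) H (IsRotLatDart H Wd) y +
      Real.cos (5 * π / 16) * rotGFy ((rotStripV H Wd).erase wOut) H IsRotBotOut y +
      Real.cos (7 * π / 16) * rotGFy ((rotStripV H Wd).erase wOut) H IsRotBotIn y +
      Real.cos (7 * π / 16) * rotGFy ((rotStripV H Wd).erase wOut) H IsRotCloseDart y +
      hexCriticalFugacity * Real.cos (5 * π / 16) =
    Real.cos (3 * π / 16) + (1 - y) *
      (( ∑ v ∈ ((rotStripV H Wd).erase wOut).filter (· ∈ rotTop H Wd),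
          ∑ P ∈ clsIn ((rotStripV H Wd).erase wOut) v,
            edir v (finalDart P).1 * pwt P * swt (rotTop H Wd) (y : ℂ) P) / emb (-1, 2) * rotPhase).re := by
  have hsum := boundary_sum_rotY_re H Wd y
  -- sort each exit term into its class: the unweighted sorting times `y^c`
  have hsort : ∀ P ∈ midWalks ((rotStripV H Wd).erase wOut),
      (if P ≠ [wOut, hvOrigin] ∧ (finalDart P).2 ∉ (rotStripV H Wd).erase wOut then
          hexCriticalFugacity ^ mwLen P * y ^ topContacts H P *
            (edir (finalDart P).1 (finalDart P).2 * lam ^ pturn P / emb (-1, 2) * rotPhase).re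
        else 0) =
      (if IsRotTopDart H (finalDart P) then hexCriticalFugacity ^ mwLen P * y ^ topContacts H P * Real.cos (π / 16) else 0) +
      (if IsRotLatDart H Wd (finalDart P) then hexCriticalFugacity ^ mwLen P * y ^ topContacts H P * Real.cos (3 * π / 16) else 0) +
      (if IsRotBotOut (finalDart P) then hexCriticalFugacity ^ mwLen P * y ^ topContacts H P * Real.cos (5 * π / 16) else 0) +
      (if IsRotBotIn (finalDart P) then hexCriticalFugacity ^ mwLen P * y ^ topContacts H P * Real.cos (7 * π / 16) else 0) +
      (if IsRotCloseDart (finalDart P) then hexCriticalFugacity ^ mwLen P * y ^ topContacts H P * Real.cos (7 * π / 16) else 0) +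
      (if IsRotStubDart (finalDart P) then hexCriticalFugacity ^ mwLen P * y ^ topContacts H P * Real.cos (5 * π / 16) else 0) := by
    intro P hP
    have hPw := mem_midWalks_iff.1 hP
    have h := exitTerm_eq_classTerms hH hW hPw
    have key := congrArg (fun t => y ^ topContacts H P * t) h
    simp only [mul_add, mul_ite, mul_zero] at key
    convert key using 2
    all_goals ring
  rw [sum_filter, sum_congr rfl hsort] at hsum
  simp only [sum_add_distrib, sum_ite_class_eq_rotGFy] at hsum
  have hstub : rotGFy ((rotStripV H Wd).erase wOut) H IsRotStubDart y = hexCriticalFugacity := by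
    rw [rotGFy, filter_isRotStubDart, sum_singleton, topContacts_stub hH]
    simp [mwLen]
  rw [hstub] at hsum
  linarith

/-! ### First arrivals at the top row: the index sets of Beaton's `Γ¹` (from below) and `Γ²` (along the row) -/

/-- The neighbour across the `Δξ = 0` edge (the tree-vertical edge; Beaton-horizontal): `(x₀,x₁,false) ↦ (x₀,x₁-1,true)`,
`(x₀,x₁,true) ↦ (x₀,x₁+1,false)` — the ROW PARTNER `r(v)`. [cite: Beaton2014RotatedHoneycomb, §2.2 (Fig. 3: the ε edges)] -/
def xiSide (v : HV) : HV := if v.2.2 then (v.1, v.2.1 + 1, false) else (v.1, v.2.1 - 1, true)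

/-- `r(v)` is a neighbour of `v`. [cite: Beaton2014RotatedHoneycomb, §2.2] -/
theorem adj_xiSide (v : HV) : hvGraph.Adj v (xiSide v) := by
  obtain ⟨a, b, c⟩ := v
  cases c <;> simp [hvGraph_adj, AdjRel, xiSide]

/-- `ξ (r v) = ξ v`. [cite: Beaton2014RotatedHoneycomb, §2.2] -/
theorem xi_xiSide (v : HV) : xi (xiSide v) = xi v := by
  obtain ⟨a, b, c⟩ := v
  cases c <;> simp [xi, xiSide, bit] <;> ring

/-- **The three neighbours of a vertex are told apart by `Δξ`**: a neighbour with `Δξ = -1` is `xiDown`, with `Δξ = 0` is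
`xiSide`. [cite: Beaton2014RotatedHoneycomb, §2.2 (Fig. 3)] -/
theorem eq_xiDown_or_xiSide_of_adj {v u : HV} (h : hvGraph.Adj v u) :
    (xi u = xi v - 1 → u = xiDown v) ∧ (xi u = xi v → u = xiSide v) := by
  obtain ⟨a, b, c⟩ := v
  obtain ⟨a', b', c'⟩ := u
  cases c <;> cases c' <;> simp [hvGraph_adj, AdjRel, xi, xiDown, xiSide, Prod.ext_iff] at h ⊢ <;> omega

/-- The `X`-shift of the row partner: `X (r v) = X v + 2` for a down-vertex, `X v - 2` for an up-vertex; in terms of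
residues, `X v ≡ 2 (mod 3)` resp. `≡ 1 (mod 3)`. [cite: Beaton2014RotatedHoneycomb, §2.2] -/
theorem xX_xiSide (v : HV) : xX (xiSide v) = (if v.2.2 then xX v + 2 else xX v - 2) ∧
    (xX v - 3) % 3 = (if v.2.2 then 2 else 1) := by
  obtain ⟨a, b, c⟩ := v
  cases c <;> simp [xX, xiSide] <;> omega

/-- **The row dimers of the top row are uncut when `H + W` is odd**: for `v ∈ D(H,W)` in the top row `ξ = -H` (`H ≥ 1`),
its row partner `r(v)` is again in `D(H,W)` — the parity `X ≡ H (mod 2)` of the row and `3 ± 3W ≢ H` place the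
lateral cuts `|X - 3| = 3W` between dimers.  (For `H + W` even the two end vertices of the top row have their partner
outside, and Beaton's relation `Γ² = x y Γ¹` fails: the lane's y-table.) [cite: Beaton2014RotatedHoneycomb, §2.4 ("we will require T + L ≡ 1 (mod 2), as we will need to pair together SAWs which end at β⁻ and β⁺ mid-edges")] -/
theorem xiSide_mem_rotStripV {H Wd : ℕ} (hH : 1 ≤ H) (hodd : Odd (H + Wd)) {v : HV}
    (hv : v ∈ rotStripV H Wd) (htop : xi v = -(H : ℤ)) : xiSide v ∈ rotStripV H Wd := by
  have hpar := xX_add_xi_even v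
  obtain ⟨hX, hmod⟩ := xX_xiSide v
  obtain ⟨k, hk⟩ := hodd
  have hk' : (H : ℤ) + Wd = 2 * k + 1 := by exact_mod_cast hk
  rcases mem_rotStripV_iff.1 hv with rfl | rfl | ⟨h1, h2, h3⟩
  · rw [xi_wOut] at htop; omega
  · rw [xi_hvOrigin] at htop; omega
  refine mem_rotStripV_of (by rw [xi_xiSide]; omega) (by rw [xi_xiSide]; omega) ?_
  rw [hX]
  rw [abs_lt] at h3 ⊢
  cases hb : v.2.2
  · simp only [hb, Bool.false_eq_true, if_false] at hmod ⊢
    omega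
  · simp only [hb, if_true] at hmod ⊢
    omega

/-- **First arrivals at the top row from BELOW** (Beaton's `γ₁` configurations, up to mirror): right-started walks of
`D(H,W) ∖ {a⁻}` whose final half-edge climbs from the row `ξ = -H+1` to an unvisited top-row vertex.
[cite: Beaton2014RotatedHoneycomb, proof of Proposition 6 ("a configuration approaching a β⁻ vertex from the south-west")] -/
def arrBelow (H Wd : ℕ) : Finset (List HV) :=
  (midWalks ((rotStripV H Wd).erase wOut)).filter fun P =>
    (finalDart P).2 ∈ (rotStripV H Wd).erase wOut ∧ xi (finalDart P).2 = -(H : ℤ) ∧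
      xi (finalDart P).1 = -(H : ℤ) + 1 ∧ (finalDart P).2 ∉ inner P

/-- **First arrivals at the top row ALONG THE ROW** (Beaton's `γ₂` configurations, up to mirror): the final half-edge is
a `Δξ = 0` edge inside the top row. [cite: Beaton2014RotatedHoneycomb, proof of Proposition 6 ("a configuration approaching a β⁻ vertex from the east")] -/
def arrRow (H Wd : ℕ) : Finset (List HV) :=
  (midWalks ((rotStripV H Wd).erase wOut)).filter fun P =>
    (finalDart P).2 ∈ (rotStripV H Wd).erase wOut ∧ xi (finalDart P).2 = -(H : ℤ) ∧
      xi (finalDart P).1 = -(H : ℤ) ∧ (finalDart P).2 ∉ inner P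

/-- Beaton's `Γ¹` with surface fugacity, right-started: `G¹(y) = Σ_{γ ∈ arrBelow} x_c^ℓ y^c`. [cite: Beaton2014RotatedHoneycomb, proof of Proposition 6 (Γ¹_{T,L}(x,y;n))] -/
def rotG1 (H Wd : ℕ) (y : ℝ) : ℝ := ∑ P ∈ arrBelow H Wd, hexCriticalFugacity ^ mwLen P * y ^ topContacts H P

/-- Beaton's `Γ²` with surface fugacity, right-started: `G²(y) = Σ_{γ ∈ arrRow} x_c^ℓ y^c`. [cite: Beaton2014RotatedHoneycomb, proof of Proposition 6 (Γ²_{T,L}(x,y;n))] -/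
def rotG2 (H Wd : ℕ) (y : ℝ) : ℝ := ∑ P ∈ arrRow H Wd, hexCriticalFugacity ^ mwLen P * y ^ topContacts H P

/-- A first arrival at a top-row vertex of `D(H,W)` comes from below or along the row (never from above: the previous
vertex lies in `D(H,W)`), and the walk is not the trivial one (`H ≥ 1`). [cite: Beaton2014RotatedHoneycomb, proof of Proposition 6 ("must approach its final vertex either from the south-west or from the east")] -/
theorem arrival_cases {H Wd : ℕ} (hH : 1 ≤ H) {P : List HV} (hP : IsMidWalk ((rotStripV H Wd).erase wOut) P)
    (h2 : xi (finalDart P).2 = -(H : ℤ)) :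
    P ≠ [wOut, hvOrigin] ∧ (xi (finalDart P).1 = -(H : ℤ) + 1 ∨ xi (finalDart P).1 = -(H : ℤ)) := by
  have hne : P ≠ [wOut, hvOrigin] := by
    rintro rfl
    rw [finalDart_trivial] at h2
    simp only [xi_hvOrigin] at h2
    omega
  refine ⟨hne, ?_⟩
  have h1 : (finalDart P).1 ∈ (rotStripV H Wd).erase wOut := finalDart_fst_mem hP hne
  have hb := (xi_bounds_of_mem_rotStripV (mem_of_mem_erase h1)).1
  rcases xi_adj hP.adj_finalDart with h | h | h <;> omega

/-- **Re-indexing the top-row defect**: the double sum `Σ_{v ∈ top row} Σ_{γ ∈ clsIn V v}` is the sum over the first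
arrivals at the top row, which split into `arrBelow` and `arrRow`. [cite: Beaton2014RotatedHoneycomb, proof of Proposition 6] -/
theorem defect_eq_sum_arrivals {H Wd : ℕ} (hH : 1 ≤ H) (f : HV → List HV → ℂ) :
    ∑ v ∈ ((rotStripV H Wd).erase wOut).filter (· ∈ rotTop H Wd),
        ∑ P ∈ clsIn ((rotStripV H Wd).erase wOut) v, f v P =
      ∑ P ∈ arrBelow H Wd, f (finalDart P).2 P + ∑ P ∈ arrRow H Wd, f (finalDart P).2 P := by
  classical
  set V := (rotStripV H Wd).erase wOut with hV
  -- exchange the sums: for each walk at most one `v` contributes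
  have h1 : ∑ v ∈ V.filter (· ∈ rotTop H Wd), ∑ P ∈ clsIn V v, f v P =
      ∑ P ∈ midWalks V, ∑ v ∈ V.filter (· ∈ rotTop H Wd),
        (if (finalDart P).2 = v ∧ v ∉ inner P then f v P else 0) := by
    rw [sum_comm]
    refine sum_congr rfl fun v _ => ?_
    rw [clsIn, sum_filter]
  have h2 : ∀ P ∈ midWalks V, ∑ v ∈ V.filter (· ∈ rotTop H Wd),
      (if (finalDart P).2 = v ∧ v ∉ inner P then f v P else 0) =
      if (finalDart P).2 ∈ V.filter (· ∈ rotTop H Wd) ∧ (finalDart P).2 ∉ inner P then f (finalDart P).2 P else 0 := by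
    intro P _
    have : ∀ v ∈ V.filter (· ∈ rotTop H Wd), (if (finalDart P).2 = v ∧ v ∉ inner P then f v P else 0) =
        if (finalDart P).2 = v then (if (finalDart P).2 ∉ inner P then f (finalDart P).2 P else 0) else 0 := by
      intro v _
      by_cases h : (finalDart P).2 = v
      · subst h; by_cases h' : (finalDart P).2 ∉ inner P <;> simp [h']
      · simp [h]
    rw [sum_congr rfl this, sum_ite_eq]
    by_cases ha : (finalDart P).2 ∈ V.filter (· ∈ rotTop H Wd) <;>
      by_cases hb : (finalDart P).2 ∉ inner P <;> simp [ha, hb]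
  rw [h1, sum_congr rfl h2, ← sum_filter]
  -- the filtered set is the disjoint union `arrBelow ∪ arrRow`
  have hset : (midWalks V).filter (fun P => (finalDart P).2 ∈ V.filter (· ∈ rotTop H Wd) ∧ (finalDart P).2 ∉ inner P) =
      arrBelow H Wd ∪ arrRow H Wd := by
    ext P
    simp only [arrBelow, arrRow, ← hV, mem_filter, mem_union, rotTop, mem_midWalks_iff]
    constructor
    · rintro ⟨hP, ⟨⟨hv2, -, hx⟩, hni⟩⟩
      rcases (arrival_cases hH hP hx).2 with h | h
      · exact Or.inl ⟨hP, hv2, hx, h, hni⟩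
      · exact Or.inr ⟨hP, hv2, hx, h, hni⟩
    · rintro (⟨hP, hv2, hx, -, hni⟩ | ⟨hP, hv2, hx, -, hni⟩) <;>
        exact ⟨hP, ⟨hv2, by rw [hV] at hv2; exact mem_of_mem_erase hv2, hx⟩, hni⟩
  have hdisj : Disjoint (arrBelow H Wd) (arrRow H Wd) := by
    rw [Finset.disjoint_left]
    intro P h1 h2
    have e1 := (mem_filter.1 h1).2.2.2.1
    have e2 := (mem_filter.1 h2).2.2.2.1
    omega
  rw [hset, sum_union hdisj]

/-! ### Windings of the first arrivals at the top row (Hopf with `c₁ = c₂ = -I`: the arrival vertex is a highest point) -/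

/-- `-I · e₀ = √3`. [folklore] -/
private theorem negI_mul_e0' : -I * emb (-1, 2) = (Real.sqrt 3 : ℂ) := by
  rw [emb_neg_one_two]; ring_nf; rw [Complex.I_sq]; ring

/-- `arg(-I · e₀) = 0`. [folklore] -/
private theorem arg_negI_mul_e0' : Complex.arg (-I * emb (-1, 2)) = 0 := by
  rw [negI_mul_e0', Complex.arg_ofReal_of_nonneg (Real.sqrt_nonneg 3)]

/-- `-I · emb(-2, 1) = √3 · ω`. [folklore] -/
private theorem negI_mul_emb_NE' : -I * emb (-2, 1) = (Real.sqrt 3 : ℂ) * omg := by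
  apply Complex.ext
  · rw [Complex.mul_re, Complex.neg_re, Complex.neg_im, Complex.I_re, Complex.I_im, emb_re, emb_im,
      Complex.re_ofReal_mul, omg_re]
    push_cast
    ring
  · rw [Complex.mul_im, Complex.neg_re, Complex.neg_im, Complex.I_re, Complex.I_im, emb_re, emb_im,
      Complex.im_ofReal_mul, omg_im]
    push_cast
    have h3 : Real.sqrt 3 * Real.sqrt 3 = 3 := Real.mul_self_sqrt (by norm_num)
    nlinarith [h3]

/-- `-I · emb(-1, -1) = √3 · ω²`. [folklore] -/
private theorem negI_mul_emb_NW' : -I * emb (-1, -1) = (Real.sqrt 3 : ℂ) * omg ^ 2 := by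
  rw [omg_sq]
  apply Complex.ext
  · rw [Complex.mul_re, Complex.neg_re, Complex.neg_im, Complex.I_re, Complex.I_im, emb_re, emb_im,
      Complex.re_ofReal_mul, Complex.sub_re, omg_re, Complex.one_re]
    push_cast
    ring
  · rw [Complex.mul_im, Complex.neg_re, Complex.neg_im, Complex.I_re, Complex.I_im, emb_re, emb_im,
      Complex.im_ofReal_mul, Complex.sub_im, omg_im, Complex.one_im]
    push_cast
    have h3 : Real.sqrt 3 * Real.sqrt 3 = 3 := Real.mul_self_sqrt (by norm_num)
    nlinarith [h3]

section Arrivals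

variable {H Wd : ℕ} {l : List HV} {u : HV}

/-- Common Hopf data of a first arrival `a⁻ :: (l ++ [u])` at a top-row vertex `u ∈ D(H,W)`, `u ∉ l`: the list is
duplicate-free and every entry has `-H ≤ ξ ≤ 0`, so both half-plane hypotheses of `hopf_path_eval` hold with `c₁ = c₂ = -I`
(`u` is a highest point), and the two chord terms cancel: `(π/3)·pturn = arg(-I·t₁)`.
[cite: Beaton2014RotatedHoneycomb, proof of Proposition 6 (the windings λ^{∓π/6}, λ^{±π/2} of γ₁, γ₂); DuminilCopinSmirnov2012, proof of Lemma 2 (Hopf)] -/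
theorem hopf_arrival (hH : 1 ≤ H) (hl : l ≠ []) (hP : IsMidWalk ((rotStripV H Wd).erase wOut) (wOut :: (l ++ [u])))
    (huV : u ∈ rotStripV H Wd) (hξu : xi u = -(H : ℤ)) (hul : u ∉ l) :
    (π / 3) * pturn (wOut :: (l ++ [u])) = Complex.arg (-I * edir (l.getLast hl) u) := by
  obtain ⟨-, hh, -, hlV, hnd, -⟩ := (isMidWalk_cons_append_iff _ hl u).1 hP
  have hlξ : ∀ x ∈ l, -(H : ℤ) ≤ xi x ∧ xi x ≤ 0 := fun x hx =>
    xi_bounds_of_mem_rotStripV (mem_of_mem_erase (hlV x hx))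
  have hwl : wOut ∉ l := fun h => (mem_erase.1 (hlV _ h)).1 rfl
  have huw : u ≠ wOut := fun h => by rw [h, xi_wOut] at hξu; omega
  have hPnd : (wOut :: (l ++ [u])).Nodup := by
    rw [List.nodup_cons, List.mem_append, List.mem_singleton, not_or]
    exact ⟨⟨hwl, Ne.symm huw⟩, hnd.append (List.nodup_singleton u) (List.disjoint_singleton.2 hul)⟩
  have hlen : (wOut :: (l ++ [u])).length = l.length + 2 := by simp
  have hentry : ∀ i ≤ l.length + 1, -(H : ℤ) ≤ xi ((wOut :: (l ++ [u])).getD i hvOrigin) ∧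
      xi ((wOut :: (l ++ [u])).getD i hvOrigin) ≤ 0 := by
    intro i hi
    rcases getD_walk_mem hi u with h | h | h
    · rw [h, xi_wOut]; omega
    · exact hlξ _ h
    · rw [h, hξu]; have := (xi_bounds_of_mem_rotStripV huV).2; omega
  have hI : (-I : ℂ) ≠ 0 := neg_ne_zero.2 Complex.I_ne_zero
  have e0 : edir wOut hvOrigin = emb (-1, 2) := by rw [edir, pos_hvOrigin, pos_wOut]; rfl
  have key := hopf_path_eval hP.1 hPnd hlen hI hI ?_ ?_
  · rw [getD_walk_last, getD_walk_prev hl, List.getD_cons_zero, getD_walk_one hh, e0, arg_negI_mul_e0'] at key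
    linarith
  · intro i hi
    rw [List.getD_cons_zero, im_negI_mul_edir, xi_wOut]
    have := (hentry i hi).2
    have : (xi ((wOut :: (l ++ [u])).getD i hvOrigin) : ℝ) ≤ 0 := by exact_mod_cast this
    nlinarith
  · intro i hi
    rw [getD_walk_last, im_negI_mul_edir, hξu]
    have h := (hentry i hi).1
    have h' : ((-(H : ℤ) : ℤ) : ℝ) ≤ (xi ((wOut :: (l ++ [u])).getD i hvOrigin) : ℝ) := by exact_mod_cast h
    push_cast at h' ⊢
    nlinarith

end Arrivals

/-- Unpacking a first arrival from below: `P = a⁻ :: (l ++ [u])`, `u` in the top row of `D(H,W)`, `u ∉ l`, the last inner vertex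
one row lower. [cite: Beaton2014RotatedHoneycomb, proof of Proposition 6] -/
private theorem arrBelow_anatomy {H Wd : ℕ} (hH : 1 ≤ H) {P : List HV} (hP : P ∈ arrBelow H Wd) :
    ∃ (l : List HV) (u : HV) (hl : l ≠ []), P = wOut :: (l ++ [u]) ∧ IsMidWalk ((rotStripV H Wd).erase wOut) P ∧
      u ∈ rotStripV H Wd ∧ xi u = -(H : ℤ) ∧ xi (l.getLast hl) = -(H : ℤ) + 1 ∧ u ∉ l ∧
      hvGraph.Adj (l.getLast hl) u ∧ finalDart P = (l.getLast hl, u) := by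
  simp only [arrBelow, mem_filter, mem_midWalks_iff] at hP
  obtain ⟨hPw, hu2, hx2, hx1, hni⟩ := hP
  obtain ⟨hne, -⟩ := arrival_cases hH hPw hx2
  rcases hPw.trivial_or_exists with rfl | ⟨l, u, hl, rfl⟩
  · exact absurd rfl hne
  rw [finalDart_cons_append hl] at hu2 hx2 hx1 hni ⊢
  rw [inner_cons_append] at hni
  obtain ⟨-, -, hadj, -, -, -⟩ := (isMidWalk_cons_append_iff _ hl u).1 hPw
  exact ⟨l, u, hl, rfl, hPw, mem_of_mem_erase hu2, hx2, hx1, hni, hadj, rfl⟩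

/-- Same for a first arrival along the row. [cite: Beaton2014RotatedHoneycomb, proof of Proposition 6] -/
private theorem arrRow_anatomy {H Wd : ℕ} (hH : 1 ≤ H) {P : List HV} (hP : P ∈ arrRow H Wd) :
    ∃ (l : List HV) (u : HV) (hl : l ≠ []), P = wOut :: (l ++ [u]) ∧ IsMidWalk ((rotStripV H Wd).erase wOut) P ∧
      u ∈ rotStripV H Wd ∧ xi u = -(H : ℤ) ∧ xi (l.getLast hl) = -(H : ℤ) ∧ u ∉ l ∧
      hvGraph.Adj (l.getLast hl) u ∧ finalDart P = (l.getLast hl, u) := by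
  simp only [arrRow, mem_filter, mem_midWalks_iff] at hP
  obtain ⟨hPw, hu2, hx2, hx1, hni⟩ := hP
  obtain ⟨hne, -⟩ := arrival_cases hH hPw hx2
  rcases hPw.trivial_or_exists with rfl | ⟨l, u, hl, rfl⟩
  · exact absurd rfl hne
  rw [finalDart_cons_append hl] at hu2 hx2 hx1 hni ⊢
  rw [inner_cons_append] at hni
  obtain ⟨-, -, hadj, -, -, -⟩ := (isMidWalk_cons_append_iff _ hl u).1 hPw
  exact ⟨l, u, hl, rfl, hPw, mem_of_mem_erase hu2, hx2, hx1, hni, hadj, rfl⟩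

/-- **Winding of a first arrival from below** (`γ₁`): `pturn = 2` arriving NW (from a down-vertex), `1` arriving NE — as for
the top exits. [cite: Beaton2014RotatedHoneycomb, proof of Proposition 6 (γ₁: j̄λ^{-π/6}); DuminilCopinSmirnov2012, proof of Lemma 2 (Hopf)] -/
theorem pturn_of_arrBelow {H Wd : ℕ} (hH : 1 ≤ H) {P : List HV} (hP : P ∈ arrBelow H Wd) :
    pturn P = if (finalDart P).1.2.2 then 2 else 1 := by
  obtain ⟨l, u, hl, rfl, hPw, huV, hxu, hxt, hul, hadj, hfd⟩ := arrBelow_anatomy hH hP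
  have key := hopf_arrival hH hl hPw huV hxu hul
  rw [hfd]
  dsimp only
  have hvec := top_exit_vector hadj (by rw [hxu, hxt]; ring)
  have hπ : (0 : ℝ) < π / 3 := by positivity
  by_cases hc : (l.getLast hl).2.2
  · rw [if_pos hc]
    rw [edir, hvec, if_pos hc, negI_mul_emb_NW', Complex.arg_real_mul _ (by positivity), arg_omg_sq] at key
    have : (π / 3) * (pturn (wOut :: (l ++ [u])) : ℝ) = (π / 3) * (2 : ℤ) := by push_cast; linarith
    exact_mod_cast mul_left_cancel₀ hπ.ne' this
  · rw [if_neg hc]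
    rw [edir, hvec, if_neg hc, negI_mul_emb_NE', Complex.arg_real_mul _ (by positivity), arg_omg] at key
    have : (π / 3) * (pturn (wOut :: (l ++ [u])) : ℝ) = (π / 3) * (1 : ℤ) := by push_cast; linarith
    exact_mod_cast mul_left_cancel₀ hπ.ne' this

/-- **Winding of a first arrival along the top row** (`γ₂`): `pturn = 0` arriving in the `+X` direction (from a down-vertex),
`3` (`W = π`) in the `-X` direction. [cite: Beaton2014RotatedHoneycomb, proof of Proposition 6 (γ₂: λ^{π/2}); DuminilCopinSmirnov2012, proof of Lemma 2 (Hopf)] -/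
theorem pturn_of_arrRow {H Wd : ℕ} (hH : 1 ≤ H) {P : List HV} (hP : P ∈ arrRow H Wd) :
    pturn P = if (finalDart P).1.2.2 then 0 else 3 := by
  obtain ⟨l, u, hl, rfl, hPw, huV, hxu, hxt, hul, hadj, hfd⟩ := arrRow_anatomy hH hP
  have key := hopf_arrival hH hl hPw huV hxu hul
  rw [hfd]
  dsimp only
  have hvec := lat_exit_vector hadj (by rw [hxu, hxt])
  have hπ : (0 : ℝ) < π / 3 := by positivity
  by_cases hc : (l.getLast hl).2.2
  · rw [if_pos hc]
    rw [edir, hvec, if_pos hc, arg_negI_mul_e0'] at key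
    have : (π / 3) * (pturn (wOut :: (l ++ [u])) : ℝ) = (π / 3) * (0 : ℤ) := by push_cast; linarith
    exact_mod_cast mul_left_cancel₀ hπ.ne' this
  · rw [if_neg hc]
    rw [edir, hvec, if_neg hc, show ((1 : ℤ), (-2 : ℤ)) = -((-1 : ℤ), (2 : ℤ)) by simp, emb_neg, mul_neg, negI_mul_e0',
      ← Complex.ofReal_neg, Complex.arg_ofReal_of_neg (by have := Real.sqrt_pos.2 (show (0:ℝ) < 3 by norm_num); linarith)]
      at key
    have : (π / 3) * (pturn (wOut :: (l ++ [u])) : ℝ) = (π / 3) * (3 : ℤ) := by push_cast; linarith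
    exact_mod_cast mul_left_cancel₀ hπ.ne' this

/-! ### The arrival terms after the normalisation by `e₀` and the phase `e^{-3πi/16}` -/

/-- `Re(λ^n · e^{-3πi/16}) = cos(n θ₅ - 3π/16)`. [folklore] -/
private theorem re_lam_zpow_mul_rotPhase'' (n : ℤ) : (lam ^ n * rotPhase).re = Real.cos (n * θ₅ - 3 * π / 16) := by
  rw [lam_zpow, rotPhase, ← Complex.exp_add, ← add_mul, ← Complex.ofReal_add, Complex.exp_ofReal_mul_I_re]
  ring_nf

/-- The normalised term with `edir = λ^a e₀` and `pturn = p` is `λ^{a+p} · e^{-3πi/16}`. [folklore] -/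
private theorem arrTerm_eq {a p : ℤ} {d : ℂ} (hd : d = lam ^ a * emb (-1, 2)) :
    d * lam ^ p / emb (-1, 2) * rotPhase = lam ^ (a + p) * rotPhase := by
  rw [hd, zpow_add₀ lam_ne_zero]
  field_simp [e0_ne_zero']

/-- The reversed arrival directions as `λ`-multiples of `e₀`: `-emb(-2,1) = λ³²e₀`, `-emb(-1,-1) = λ⁴⁰e₀`, `-e₀ = λ²⁴e₀`,
`-emb(1,-2) = λ⁰ e₀`. [folklore] -/
private theorem rev_dirs_eq_lam_zpow :
    -emb (-2, 1) = lam ^ (32 : ℤ) * emb (-1, 2) ∧ -emb (-1, -1) = lam ^ (40 : ℤ) * emb (-1, 2) ∧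
    -emb (-1, 2) = lam ^ (24 : ℤ) * emb (-1, 2) ∧ -emb (1, -2) = lam ^ (0 : ℤ) * emb (-1, 2) := by
  have h8 : lam ^ (8 : ℤ) = omg := lam_zpow_eight
  have h16 : lam ^ (16 : ℤ) = omg ^ 2 := by
    rw [show (16 : ℤ) = 8 + 8 by norm_num, zpow_add₀ lam_ne_zero, h8, sq]
  have h24 : lam ^ (24 : ℤ) = -1 := by
    rw [show (24 : ℤ) = 16 + 8 by norm_num, zpow_add₀ lam_ne_zero, h16, h8, ← pow_succ, omg_pow_three]
  have h32 : lam ^ (32 : ℤ) = -omg := by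
    rw [show (32 : ℤ) = 24 + 8 by norm_num, zpow_add₀ lam_ne_zero, h24, h8]; ring
  have h40 : lam ^ (40 : ℤ) = -omg ^ 2 := by
    rw [show (40 : ℤ) = 24 + 16 by norm_num, zpow_add₀ lam_ne_zero, h24, h16]; ring
  have e3 := omg_pow_three
  have e2 := omg_sq
  rw [h32, h40, h24, zpow_zero]
  simp only [emb]
  push_cast
  refine ⟨?_, ?_, ?_, ?_⟩
  · linear_combination (2 : ℂ) * e2
  · linear_combination -e2 + 2 * e3
  · ring
  · ring

/-- **The `γ₁` term**: for a first arrival from below, `Re[(u - t)·λ^{W}/e₀ · e^{-3πi/16}]` with the direction REVERSED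
(`edir u t`, as it enters the defect `(t - v)` of the vertex relation at `v = u`) is `-cos(π/16)` (`λ³³` NE, `λ⁴²` NW).
[cite: Beaton2014RotatedHoneycomb, proof of Proposition 6 (coefficient of Γ¹)] -/
theorem arrTerm_re_of_arrBelow {H Wd : ℕ} (hH : 1 ≤ H) {P : List HV} (hP : P ∈ arrBelow H Wd) :
    (edir (finalDart P).2 (finalDart P).1 * lam ^ pturn P / emb (-1, 2) * rotPhase).re = -Real.cos (π / 16) := by
  have hpt := pturn_of_arrBelow hH hP
  obtain ⟨l, u, hl, rfl, hPw, huV, hxu, hxt, hul, hadj, hfd⟩ := arrBelow_anatomy hH hP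
  rw [hfd] at hpt ⊢
  dsimp only at hpt ⊢
  have hvec := top_exit_vector hadj (by rw [hxu, hxt]; ring)
  obtain ⟨d32, d40, -, -⟩ := rev_dirs_eq_lam_zpow
  rw [edir_rev, edir, hvec]
  by_cases hc : (l.getLast hl).2.2
  · rw [if_pos hc] at hpt ⊢
    rw [hpt, arrTerm_eq (a := 40) d40, re_lam_zpow_mul_rotPhase'',
      show (((40 + 2 : ℤ) : ℝ)) * θ₅ - 3 * π / 16 = (π / 16 + π) - ((5 : ℤ) : ℝ) * (2 * π) by rw [θ₅]; push_cast; ring,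
      Real.cos_sub_int_mul_two_pi, Real.cos_add_pi]
  · rw [if_neg hc] at hpt ⊢
    rw [hpt, arrTerm_eq (a := 32) d32, re_lam_zpow_mul_rotPhase'',
      show (((32 + 1 : ℤ) : ℝ)) * θ₅ - 3 * π / 16 = (π - π / 16) - ((4 : ℤ) : ℝ) * (2 * π) by rw [θ₅]; push_cast; ring,
      Real.cos_sub_int_mul_two_pi, Real.cos_pi_sub]

/-- **The `γ₂` term**: for a first arrival along the row, the reversed normalised direction has real part `-cos(3π/16)`
(`λ²⁴` / `λ³`). [cite: Beaton2014RotatedHoneycomb, proof of Proposition 6 (coefficient of Γ²)] -/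
theorem arrTerm_re_of_arrRow {H Wd : ℕ} (hH : 1 ≤ H) {P : List HV} (hP : P ∈ arrRow H Wd) :
    (edir (finalDart P).2 (finalDart P).1 * lam ^ pturn P / emb (-1, 2) * rotPhase).re = -Real.cos (3 * π / 16) := by
  have hpt := pturn_of_arrRow hH hP
  obtain ⟨l, u, hl, rfl, hPw, huV, hxu, hxt, hul, hadj, hfd⟩ := arrRow_anatomy hH hP
  rw [hfd] at hpt ⊢
  dsimp only at hpt ⊢
  have hvec := lat_exit_vector hadj (by rw [hxu, hxt])
  obtain ⟨-, -, d24, d0⟩ := rev_dirs_eq_lam_zpow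
  rw [edir_rev, edir, hvec]
  by_cases hc : (l.getLast hl).2.2
  · rw [if_pos hc] at hpt ⊢
    rw [hpt, arrTerm_eq (a := 24) d24, re_lam_zpow_mul_rotPhase'',
      show (((24 + 0 : ℤ) : ℝ)) * θ₅ - 3 * π / 16 = (π - 3 * π / 16) - ((3 : ℤ) : ℝ) * (2 * π) by rw [θ₅]; push_cast; ring,
      Real.cos_sub_int_mul_two_pi, Real.cos_pi_sub]
  · rw [if_neg hc] at hpt ⊢
    rw [hpt, arrTerm_eq (a := 0) d0, re_lam_zpow_mul_rotPhase'',
      show (((0 + 3 : ℤ) : ℝ)) * θ₅ - 3 * π / 16 = -(π - 3 * π / 16) by rw [θ₅]; push_cast; ring,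
      Real.cos_neg, Real.cos_pi_sub]

/-- **The top-row defect evaluated**: `Re[𝔇 · e^{-3πi/16}/e₀] = -cos(π/16) G¹(y) - cos(3π/16) G²(y)`.
[cite: Beaton2014RotatedHoneycomb, proof of Proposition 6 (the contribution of all β⁻ and β⁺ vertices)] -/
theorem defect_re {H Wd : ℕ} (hH : 1 ≤ H) (y : ℝ) :
    (( ∑ v ∈ ((rotStripV H Wd).erase wOut).filter (· ∈ rotTop H Wd),
        ∑ P ∈ clsIn ((rotStripV H Wd).erase wOut) v,
          edir v (finalDart P).1 * pwt P * swt (rotTop H Wd) (y : ℂ) P) / emb (-1, 2) * rotPhase).re =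
      -(Real.cos (π / 16) * rotG1 H Wd y + Real.cos (3 * π / 16) * rotG2 H Wd y) := by
  rw [defect_eq_sum_arrivals hH (fun v P => edir v (finalDart P).1 * pwt P * swt (rotTop H Wd) (y : ℂ) P)]
  -- per-term evaluation on a set of arrivals with a common real part `c`
  have hblock : ∀ (T : Finset (List HV)) (c : ℝ),
      (∀ P ∈ T, IsMidWalk ((rotStripV H Wd).erase wOut) P ∧
        (edir (finalDart P).2 (finalDart P).1 * lam ^ pturn P / emb (-1, 2) * rotPhase).re = c) →
      ((∑ P ∈ T, edir (finalDart P).2 (finalDart P).1 * pwt P * swt (rotTop H Wd) (y : ℂ) P) / emb (-1, 2) *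
          rotPhase).re = c * ∑ P ∈ T, hexCriticalFugacity ^ mwLen P * y ^ topContacts H P := by
    intro T c hT
    rw [sum_div, sum_mul, Complex.re_sum, mul_sum]
    refine sum_congr rfl fun P hP => ?_
    obtain ⟨hPw, hc⟩ := hT P hP
    rw [swt_rotTop hPw, pwt, show edir (finalDart P).2 (finalDart P).1 *
        ((hexCriticalFugacity : ℂ) ^ mwLen P * lam ^ pturn P) * ((y ^ topContacts H P : ℝ) : ℂ) / emb (-1, 2) * rotPhase =
      ((hexCriticalFugacity ^ mwLen P * y ^ topContacts H P : ℝ) : ℂ) *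
        (edir (finalDart P).2 (finalDart P).1 * lam ^ pturn P / emb (-1, 2) * rotPhase) by push_cast; ring,
      Complex.re_ofReal_mul, hc]
    ring
  have h1 := hblock (arrBelow H Wd) (-Real.cos (π / 16)) fun P hP =>
    ⟨mem_midWalks_iff.1 (mem_filter.1 hP).1, arrTerm_re_of_arrBelow hH hP⟩
  have h2 := hblock (arrRow H Wd) (-Real.cos (3 * π / 16)) fun P hP =>
    ⟨mem_midWalks_iff.1 (mem_filter.1 hP).1, arrTerm_re_of_arrRow hH hP⟩
  rw [add_div, add_mul, Complex.add_re, h1, h2, rotG1, rotG2]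
  ring

/-! ### `B(y) = x y (G¹(y) + G²(y))`: every top exit is a first arrival at the top row plus the step out -/

/-- The top exit out of a first arrival: append the unique upper neighbour `xiDown v` of the arrival vertex `v`.  It is a
right-started walk of `D(H,W) ∖ {a⁻}` whose final dart is a top dart, one vertex longer, with one more surface contact.
[cite: Beaton2014RotatedHoneycomb, proof of Proposition 6 ("any walk counted by B_{T,L} can be obtained by extending a unique Γ¹_{T,L} walk (or a reflected one) by either a single step or by two steps")] -/
theorem topExit_of_arrival {H Wd : ℕ} {P : List HV} (hP : P ∈ arrBelow H Wd ∪ arrRow H Wd) :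
    IsMidWalk ((rotStripV H Wd).erase wOut) (P ++ [xiDown (finalDart P).2]) ∧
      IsRotTopDart H (finalDart (P ++ [xiDown (finalDart P).2])) ∧
      mwLen (P ++ [xiDown (finalDart P).2]) = mwLen P + 1 ∧
      topContacts H (P ++ [xiDown (finalDart P).2]) = topContacts H P + 1 := by
  have hmem : IsMidWalk ((rotStripV H Wd).erase wOut) P ∧ (finalDart P).2 ∈ (rotStripV H Wd).erase wOut ∧
      xi (finalDart P).2 = -(H : ℤ) ∧ (finalDart P).2 ∉ inner P ∧
      (xi (finalDart P).1 = -(H : ℤ) + 1 ∨ xi (finalDart P).1 = -(H : ℤ)) := by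
    rcases mem_union.1 hP with h | h
    · simp only [arrBelow, mem_filter, mem_midWalks_iff] at h
      exact ⟨h.1, h.2.1, h.2.2.1, h.2.2.2.2, Or.inl h.2.2.2.1⟩
    · simp only [arrRow, mem_filter, mem_midWalks_iff] at h
      exact ⟨h.1, h.2.1, h.2.2.1, h.2.2.2.2, Or.inr h.2.2.2.1⟩
  obtain ⟨hPw, hv2, hx2, hni, hx1⟩ := hmem
  set v := (finalDart P).2 with hv
  have hne : xiDown v ≠ (finalDart P).1 := by
    intro h; have := congrArg xi h; rw [xi_xiDown] at this; omega
  obtain ⟨hQ, hfd, hlen, hinner⟩ := hPw.append_singleton rfl hv2 hni (adj_xiDown v) hne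
  refine ⟨hQ, ?_, hlen, ?_⟩
  · rw [hfd]; exact ⟨hx2, by rw [xi_xiDown, hx2]⟩
  · rw [topContacts, topContacts, hinner, List.countP_append]
    rw [hv] at hx2
    simp [hx2]

/-- **`B(y) = x_c y (G¹(y) + G²(y))`** (right-started): the top exits of `D(H,W) ∖ {a⁻}` are in bijection with the first arrivals
at the top row (drop / append the step out), the weight gaining `x_c y`. [cite: Beaton2014RotatedHoneycomb, proof of Proposition 6 (B_{T,L}(x,y;n) = 2(xy + x²y²)Γ¹_{T,L}(x,y;n))] -/
theorem rotGFy_top_eq {H Wd : ℕ} (hH : 1 ≤ H) (y : ℝ) :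
    rotGFy ((rotStripV H Wd).erase wOut) H (IsRotTopDart H) y =
      hexCriticalFugacity * y * (rotG1 H Wd y + rotG2 H Wd y) := by
  classical
  set V := (rotStripV H Wd).erase wOut with hV
  set A := arrBelow H Wd ∪ arrRow H Wd with hA
  set Φ : List HV → List HV := fun P => P ++ [xiDown (finalDart P).2] with hΦ
  have hw : wOut ∉ V := notMem_erase _ _
  -- the image of `Φ` is exactly the set of top exits
  have himage : (midWalks V).filter (fun Q => IsRotTopDart H (finalDart Q)) = A.image Φ := by
    ext Q
    simp only [mem_filter, mem_image, mem_midWalks_iff]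
    constructor
    · rintro ⟨hQ, htop⟩
      have hQne : Q ≠ [wOut, hvOrigin] := by
        rintro rfl; rw [finalDart_trivial] at htop; have := htop.1; simp only [xi_wOut] at this; omega
      have hvV : (finalDart Q).1 ∈ V := finalDart_fst_mem hQ hQne
      obtain ⟨hQ', h2, hni, hadj', -⟩ := hQ.dropLast_spec hw hvV rfl
      have hQnil : Q ≠ [] := by rintro rfl; exact absurd hQ.two_le_length (by simp)
      have hlast : (finalDart Q).2 = Q.getLast hQnil := by
        simp only [finalDart, List.getLast?_eq_some_getLast hQnil, Option.getD_some]
      have hout : (finalDart Q).2 = xiDown (finalDart Q).1 :=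
        (eq_xiDown_or_xiSide_of_adj hQ.adj_finalDart).1 (by rw [htop.1, htop.2])
      refine ⟨Q.dropLast, ?_, ?_⟩
      · -- `Q.dropLast` is a first arrival at the top-row vertex `(finalDart Q).1`
        have hx1 := (arrival_cases hH hQ' (by rw [h2]; exact htop.1)).2
        rw [hA, mem_union]
        simp only [arrBelow, arrRow, mem_filter, mem_midWalks_iff, h2]
        rcases hx1 with h | h
        · exact Or.inl ⟨hQ', hvV, htop.1, h, hni⟩
        · exact Or.inr ⟨hQ', hvV, htop.1, h, hni⟩
      · rw [hΦ]
        dsimp only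
        rw [h2, ← hout, hlast, List.dropLast_append_getLast hQnil]
    · rintro ⟨P, hPA, rfl⟩
      rw [hA] at hPA
      obtain ⟨hQ, htop, -, -⟩ := topExit_of_arrival hPA
      exact ⟨hQ, htop⟩
  have hinj : Set.InjOn Φ A := fun P _ P' _ h => by
    simpa [hΦ, List.dropLast_concat] using congrArg List.dropLast h
  have hdisj : Disjoint (arrBelow H Wd) (arrRow H Wd) := by
    rw [Finset.disjoint_left]
    intro P h1 h2
    have e1 := (mem_filter.1 h1).2.2.2.1
    have e2 := (mem_filter.1 h2).2.2.2.1
    omega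
  rw [rotGFy, himage, sum_image hinj, rotG1, rotG2, ← sum_union hdisj, ← hA, mul_sum]
  refine sum_congr rfl fun P hP => ?_
  obtain ⟨-, -, hlen, hc⟩ := topExit_of_arrival (by rw [hA] at hP; exact hP)
  simp only [hΦ] at hlen hc ⊢
  rw [hlen, hc, pow_succ, pow_succ]
  ring

/-! ### `G²(y) = x y G¹(y)` for `H + W` odd: the row-dimer bijection (replaces Beaton's reflection argument) -/

/-- `r(r(v)) = v`. [cite: Beaton2014RotatedHoneycomb, §2.2] -/
theorem xiSide_xiSide (v : HV) : xiSide (xiSide v) = v := by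
  obtain ⟨a, b, c⟩ := v
  cases c <;> simp [xiSide]

/-- The neighbour with `Δξ = +1` is unique. [cite: Beaton2014RotatedHoneycomb, §2.2 (Fig. 3)] -/
theorem eq_of_adj_xi_succ {r z z' : HV} (hz : hvGraph.Adj r z) (hz' : hvGraph.Adj r z') (h1 : xi z = xi r + 1)
    (h2 : xi z' = xi r + 1) : z = z' := by
  obtain ⟨a, b, c⟩ := r
  obtain ⟨a1, b1, c1⟩ := z
  obtain ⟨a2, b2, c2⟩ := z'
  cases c <;> cases c1 <;> cases c2 <;> simp [hvGraph_adj, AdjRel, xi, Prod.ext_iff] at hz hz' h1 h2 ⊢ <;> omega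

/-- The first component of the final dart is a vertex of the walk list or the outer vertex `a⁻`. [folklore] -/
private theorem finalDart_fst_mem_or_eq (P : List HV) : (finalDart P).1 ∈ P ∨ (finalDart P).1 = wOut := by
  simp only [finalDart]
  cases h : P.dropLast.getLast? with
  | none => exact Or.inr (by simp)
  | some x =>
    left
    rw [Option.getD_some]
    exact List.dropLast_subset P (List.mem_of_getLast? h)

/-- **No re-entry**: a walk arriving at a top-row vertex `v` from below has not visited the row partner `r(v)` — a walk
passing through `r(v)` enters and leaves it through neighbours with `Δξ = +1` (the partner `v` is unvisited, the upper
neighbour is outside the domain), and there is only one such neighbour. [cite: Beaton2014RotatedHoneycomb, proof of Proposition 6 ("any γ₂ walk is an extension of a unique reflected γ₁ walk")] -/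
theorem xiSide_notMem_of_arrBelow {H Wd : ℕ} (hH : 1 ≤ H) {P : List HV} (hP : P ∈ arrBelow H Wd) :
    xiSide (finalDart P).2 ∉ inner P := by
  obtain ⟨l, u, hl, rfl, hPw, huV, hxu, hxt, hul, hadj, hfd⟩ := arrBelow_anatomy hH hP
  rw [hfd, inner_cons_append]
  dsimp only
  intro hr
  obtain ⟨hc, hh, -, hlV, hnd, -⟩ := (isMidWalk_cons_append_iff _ hl u).1 hPw
  obtain ⟨i, hi, hri⟩ := List.getElem_of_mem hr
  have hξr : xi (xiSide u) = -(H : ℤ) := by rw [xi_xiSide, hxu]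
  have hlξ : ∀ x ∈ l, -(H : ℤ) ≤ xi x := fun x hx => (xi_bounds_of_mem_rotStripV (mem_of_mem_erase (hlV x hx))).1
  -- `i` is neither the first index (`l[0] = a⁺`, `ξ = 0`) nor the last (`ξ(t) = -H + 1`)
  have h0 : l[0]'(List.length_pos_of_ne_nil hl) = hvOrigin := by
    cases l with
    | nil => exact absurd rfl hl
    | cons a t => simpa using hh
  have hi0 : i ≠ 0 := by
    rintro rfl
    have := congrArg xi (hri.trans rfl)
    rw [h0, xi_hvOrigin, hξr] at this
    omega
  have hilast : i + 1 < l.length := by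
    by_contra hcon
    have hieq : i = l.length - 1 := by omega
    have : l[i] = l.getLast hl := by rw [List.getLast_eq_getElem]; simp only [hieq]
    have := congrArg xi this
    rw [hri, hξr, hxt] at this
    omega
  -- the two neighbours of `r(u)` along the walk
  have hnext : hvGraph.Adj (xiSide u) (l[i + 1]'hilast) := by
    have := List.isChain_iff_getElem.1 hc i hilast
    rwa [hri] at this
  have hprev : hvGraph.Adj (xiSide u) (l[i - 1]'(by omega)) := by
    have := List.isChain_iff_getElem.1 hc (i - 1) (by omega)
    have e : i - 1 + 1 = i := by omega
    simp only [e] at this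
    rw [hri] at this
    exact this.symm
  -- both have `ξ = ξ(r(u)) + 1`
  have hup : ∀ z ∈ l, hvGraph.Adj (xiSide u) z → xi z = xi (xiSide u) + 1 := by
    intro z hz hz'
    have hzξ := hlξ z hz
    rcases xi_adj hz' with h | h | h
    · exfalso
      have : z = xiSide (xiSide u) := (eq_xiDown_or_xiSide_of_adj hz').2 h
      rw [xiSide_xiSide] at this
      exact hul (this ▸ hz)
    · exact h
    · omega
  have e := eq_of_adj_xi_succ hprev hnext (hup _ (List.getElem_mem _) hprev) (hup _ (List.getElem_mem _) hnext)
  have := (List.Nodup.getElem_inj_iff hnd).1 e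
  omega

/-- Extending a first arrival from below along the row: for `H + W` odd, `γ ↦ γ ++ [r(v)]` lands in `arrRow`, with one more
vertex and one more surface contact. [cite: Beaton2014RotatedHoneycomb, proof of Proposition 6 (Γ² = x y Γ¹)] -/
theorem rowExt_of_arrBelow {H Wd : ℕ} (hH : 1 ≤ H) (hodd : Odd (H + Wd)) {P : List HV} (hP : P ∈ arrBelow H Wd) :
    P ++ [xiSide (finalDart P).2] ∈ arrRow H Wd ∧
      mwLen (P ++ [xiSide (finalDart P).2]) = mwLen P + 1 ∧
      topContacts H (P ++ [xiSide (finalDart P).2]) = topContacts H P + 1 := by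
  have hnr := xiSide_notMem_of_arrBelow hH hP
  have hP' := hP
  simp only [arrBelow, mem_filter, mem_midWalks_iff] at hP'
  obtain ⟨hPw, hv2, hx2, hx1, hni⟩ := hP'
  set v := (finalDart P).2 with hv
  have hrV : xiSide v ∈ rotStripV H Wd := xiSide_mem_rotStripV hH hodd (mem_of_mem_erase hv2) hx2
  have hrV' : xiSide v ∈ (rotStripV H Wd).erase wOut :=
    mem_erase.2 ⟨fun h => by have := congrArg xi h; rw [xi_xiSide, hx2, xi_wOut] at this; omega, hrV⟩
  have hne : xiSide v ≠ (finalDart P).1 := by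
    intro h; have := congrArg xi h; rw [xi_xiSide] at this; omega
  obtain ⟨hQ, hfd, hlen, hinner⟩ := hPw.append_singleton rfl hv2 hni (adj_xiSide v) hne
  refine ⟨?_, hlen, ?_⟩
  · simp only [arrRow, mem_filter, mem_midWalks_iff, hfd]
    refine ⟨hQ, hrV', by rw [xi_xiSide, hx2], hx2, ?_⟩
    rw [hinner, List.mem_append, List.mem_singleton, not_or]
    exact ⟨hnr, (hvGraph.ne_of_adj (adj_xiSide v)).symm⟩
  · rw [topContacts, topContacts, hinner, List.countP_append]
    rw [hv] at hx2
    simp [hx2]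

/-- A first arrival along the row IS such an extension: dropping its last vertex gives a first arrival from below at the
row partner. [cite: Beaton2014RotatedHoneycomb, proof of Proposition 6] -/
theorem arrRow_eq_rowExt {H Wd : ℕ} (hH : 1 ≤ H) {Q : List HV} (hQ : Q ∈ arrRow H Wd) :
    Q.dropLast ∈ arrBelow H Wd ∧ Q = Q.dropLast ++ [xiSide (finalDart Q.dropLast).2] := by
  have hw : wOut ∉ (rotStripV H Wd).erase wOut := notMem_erase _ _
  have hQ' := hQ
  simp only [arrRow, mem_filter, mem_midWalks_iff] at hQ'
  obtain ⟨hQw, hu2, hxu, hxt, hni⟩ := hQ'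
  have hQne : Q ≠ [wOut, hvOrigin] := (arrival_cases hH hQw hxu).1
  have htV : (finalDart Q).1 ∈ (rotStripV H Wd).erase wOut := finalDart_fst_mem hQw hQne
  obtain ⟨hP, h2, hniP, hadjP, -⟩ := hQw.dropLast_spec hw htV rfl
  have hu : (finalDart Q).2 = xiSide (finalDart Q).1 :=
    (eq_xiDown_or_xiSide_of_adj hQw.adj_finalDart).2 (by rw [hxu, hxt])
  have hQnil : Q ≠ [] := by rintro rfl; exact absurd hQw.two_le_length (by simp)
  have hlast : (finalDart Q).2 = Q.getLast hQnil := by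
    simp only [finalDart, List.getLast?_eq_some_getLast hQnil, Option.getD_some]
  refine ⟨?_, ?_⟩
  · simp only [arrBelow, mem_filter, mem_midWalks_iff, h2]
    refine ⟨hP, htV, hxt, ?_, hniP⟩
    rcases (arrival_cases hH hP (by rw [h2]; exact hxt)).2 with h | h
    · exact h
    · -- the previous vertex cannot be the row partner of `t`: that is the (unvisited, outer) arrival vertex `u`
      exfalso
      have hs : (finalDart Q.dropLast).1 = xiSide (finalDart Q).1 :=
        (eq_xiDown_or_xiSide_of_adj hadjP).2 (by rw [h, hxt])
      rw [← hu] at hs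
      -- `(finalDart Q.dropLast).1` is a vertex of `Q.dropLast` or `a⁻`; `u` is neither
      rcases finalDart_fst_mem_or_eq Q.dropLast with hm | hm
      · rw [hs] at hm
        -- vertices of `Q.dropLast` : `a⁻` or inner vertices of `Q`
        rcases hQw.trivial_or_exists with rfl | ⟨l, u, hl, rfl⟩
        · exact hQne rfl
        · have hd : (wOut :: (l ++ [u])).dropLast = wOut :: l := by
            rw [← List.cons_append, List.dropLast_concat]
          rw [hd, List.mem_cons] at hm
          rw [finalDart_cons_append hl] at hm hni hxu
          rw [inner_cons_append] at hni
          simp only at hm hni hxu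
          rcases hm with hm | hm
          · rw [hm, xi_wOut] at hxu; omega
          · exact hni hm
      · rw [hs] at hm; rw [hm, xi_wOut] at hxu; omega
  · conv_lhs => rw [← List.dropLast_append_getLast hQnil]
    rw [← hlast, hu, h2]

/-- **`G²(y) = x_c y G¹(y)` for `H + W` odd** (right-started; Beaton's `Γ² = x y Γ¹`, here by the row-dimer bijection
`γ ↦ γ ++ [r(v)]` instead of the reflection in the vertical axis). [cite: Beaton2014RotatedHoneycomb, proof of Proposition 6 (Γ²_{T,L}(x,y;n) = x y Γ¹_{T,L}(x,y;n))] -/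
theorem rotG2_eq {H Wd : ℕ} (hH : 1 ≤ H) (hodd : Odd (H + Wd)) (y : ℝ) :
    rotG2 H Wd y = hexCriticalFugacity * y * rotG1 H Wd y := by
  classical
  set Ψ : List HV → List HV := fun P => P ++ [xiSide (finalDart P).2] with hΨ
  have himage : arrRow H Wd = (arrBelow H Wd).image Ψ := by
    ext Q
    simp only [mem_image]
    constructor
    · intro hQ
      obtain ⟨h1, h2⟩ := arrRow_eq_rowExt hH hQ
      exact ⟨Q.dropLast, h1, h2.symm⟩
    · rintro ⟨P, hP, rfl⟩
      exact (rowExt_of_arrBelow hH hodd hP).1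
  have hinj : Set.InjOn Ψ (arrBelow H Wd) := fun P _ P' _ h => by
    simpa [hΨ, List.dropLast_concat] using congrArg List.dropLast h
  rw [rotG2, himage, sum_image hinj, rotG1, mul_sum]
  refine sum_congr rfl fun P hP => ?_
  obtain ⟨-, hlen, hc⟩ := rowExt_of_arrBelow hH hodd hP
  simp only [hΨ] at hlen hc ⊢
  rw [hlen, hc, pow_succ, pow_succ]
  ring

/-! ### Assembly: Beaton's Proposition 6 at `n = 0` for `D(H, W)`, right-started, `H + W` odd -/

/-- Trigonometric constants of the rotated frame: `2 x_c cos(π/8) = 1`, `cos(π/16) + cos(5π/16) = 2cos(3π/16)cos(π/8)`,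
`cos(π/16) + cos(3π/16) = 2cos(π/8)cos(π/16)`, `cos(17π/16) = -cos(π/16)`, `sin(3π/16) = cos(5π/16)`, `sin(π/16) = cos(7π/16)`.
[cite: Beaton2014RotatedHoneycomb, Proposition 6 (the coefficients at n = 0)] -/
theorem rot_trig_facts :
    2 * hexCriticalFugacity * Real.cos (π / 8) = 1 ∧
    Real.cos (π / 16) + Real.cos (5 * π / 16) = 2 * Real.cos (3 * π / 16) * Real.cos (π / 8) ∧
    Real.cos (π / 16) + Real.cos (3 * π / 16) = 2 * Real.cos (π / 8) * Real.cos (π / 16) ∧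
    Real.cos (17 * π / 16) = -Real.cos (π / 16) ∧
    Real.sin (3 * π / 16) = Real.cos (5 * π / 16) ∧ Real.sin (π / 16) = Real.cos (7 * π / 16) := by
  refine ⟨two_mul_hexCriticalFugacity_mul_cos_pi_div_eight, ?_, ?_, ?_, ?_, ?_⟩
  · rw [Real.cos_add_cos, show (π / 16 + 5 * π / 16) / 2 = 3 * π / 16 by ring,
      show (π / 16 - 5 * π / 16) / 2 = -(π / 8) by ring, Real.cos_neg]
  · rw [Real.cos_add_cos, show (π / 16 + 3 * π / 16) / 2 = π / 8 by ring,
      show (π / 16 - 3 * π / 16) / 2 = -(π / 16) by ring, Real.cos_neg]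
  · rw [show 17 * π / 16 = π / 16 + π by ring, Real.cos_add_pi]
  · rw [← Real.cos_pi_div_two_sub]; congr 1; ring
  · rw [← Real.cos_pi_div_two_sub]; congr 1; ring

/-- `B(y) = x_c y (1 + x_c y) G¹(y)` for `H + W` odd. [cite: Beaton2014RotatedHoneycomb, proof of Proposition 6 (B_{T,L} = 2(xy + x²y²)Γ¹_{T,L})] -/
theorem rotGFy_top_eq_G1 {H Wd : ℕ} (hH : 1 ≤ H) (hodd : Odd (H + Wd)) (y : ℝ) :
    rotGFy ((rotStripV H Wd).erase wOut) H (IsRotTopDart H) y =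
      hexCriticalFugacity * y * (1 + hexCriticalFugacity * y) * rotG1 H Wd y := by
  rw [rotGFy_top_eq hH, rotG2_eq hH hodd]; ring

/-- **The surface-fugacity identity, division-free master form** (`H, W ≥ 1`, `H + W` odd, every real `y`):
`2sin(3π/16) A^O(y) + 2sin(π/16) A^I(y) + 2cos(3π/16) E(y) + 2cos(π/16) B(y) + 2cos(7π/16) P(y)
   + 2(1 - y)(cos(π/16) + x_c y cos(3π/16)) G¹(y) = 2 x_c cos(π/16)`, with `B(y) = x_c y (1 + x_c y) G¹(y)`
(`rotGFy_top_eq_G1`).  At `y = 1` this is Proposition 4 (`rotStrip_identity`). [cite: Beaton2014RotatedHoneycomb, §2.4, proof of Proposition 6 (arXiv v3 pp. 9–10)] -/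
theorem rotStrip_identityY_master {H Wd : ℕ} (hH : 1 ≤ H) (hW : 1 ≤ Wd) (hodd : Odd (H + Wd)) (y : ℝ) :
    2 * Real.sin (3 * Real.pi / 16) * rotGFy ((rotStripV H Wd).erase wOut) H IsRotBotOut y +
      2 * Real.sin (Real.pi / 16) * rotGFy ((rotStripV H Wd).erase wOut) H IsRotBotIn y +
      2 * Real.cos (3 * Real.pi / 16) * rotGFy ((rotStripV H Wd).erase wOut) H (IsRotLatDart H Wd) y +
      2 * Real.cos (Real.pi / 16) * rotGFy ((rotStripV H Wd).erase wOut) H (IsRotTopDart H) y +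
      2 * Real.cos (7 * Real.pi / 16) * rotGFy ((rotStripV H Wd).erase wOut) H IsRotCloseDart y +
      2 * (1 - y) * (Real.cos (Real.pi / 16) + hexCriticalFugacity * y * Real.cos (3 * Real.pi / 16)) * rotG1 H Wd y =
    2 * hexCriticalFugacity * Real.cos (Real.pi / 16) := by
  have hcls := classSum_rotY hH hW y
  rw [defect_re hH] at hcls
  have hG2 := rotG2_eq hH hodd y
  obtain ⟨hK1, hT2, -, -, hs3, hs1⟩ := rot_trig_facts
  rw [hs3, hs1]
  linear_combination 2 * hcls + (-2 * (1 - y) * Real.cos (3 * π / 16)) * hG2 +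
    (-2 * hexCriticalFugacity) * hT2 + (-2 * Real.cos (3 * π / 16)) * hK1

/-- **Beaton's coefficient**: the printed `B`-correction `((1 - x_c y - x_c²y²)cos(17π/16) + x_c²y² cos(5π/16))` equals
`-(1 - y)(cos(π/16) + x_c y cos(3π/16))` (using `2x_c cos(π/8) = 1`). [cite: Beaton2014RotatedHoneycomb, Proposition 6 (the bracket coefficient of B_{T,L} at n = 0)] -/
theorem beaton_coeff_eq (y : ℝ) :
    (1 - hexCriticalFugacity * y - hexCriticalFugacity ^ 2 * y ^ 2) * Real.cos (17 * π / 16) +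
        hexCriticalFugacity ^ 2 * y ^ 2 * Real.cos (5 * π / 16) =
      -((1 - y) * (Real.cos (π / 16) + hexCriticalFugacity * y * Real.cos (3 * π / 16))) := by
  obtain ⟨hK1, hT2, hT3, hc17, -, -⟩ := rot_trig_facts
  rw [hc17]
  linear_combination (hexCriticalFugacity ^ 2 * y ^ 2) * hT2 + (hexCriticalFugacity * y) * hT3 +
    (y * Real.cos (π / 16) + hexCriticalFugacity * y ^ 2 * Real.cos (3 * π / 16)) * hK1

/-- **Beaton 2014, Proposition 6 at `n = 0`, for the rotated strip `D(H, W)`, right-started** (face K96.1 «ROT-STRIP-IDENTITY-Y»,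
the lane's typed form): for `H, W ≥ 1` with `H + W` ODD and `y > 0`, with the class generating functions weighted
`x_c^ℓ y^{c}` (`c` = visits to the top row),
`2sin(3π/16) A^O + 2sin(π/16) A^I + 2cos(3π/16) E + 2[cos(π/16) - corr(y)] B + 2cos(7π/16) P = 2 x_c cos(π/16)`,
`corr(y) = ((1 - x_c y - x_c²y²)cos(17π/16) + x_c²y² cos(5π/16)) / (x_c y (1 + x_c y))` — the printed bracket at
`θ = π/2` on the branch `x_c^{-1} = 2cos(π/8)` (`cos(5(π-θ)/8) = cos(5π/16)`, `cos((9π-θ)/8) = cos(17π/16)`), right-started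
halving as in Prop. 4 (`HexSAWRotStripClasses`).  The parity hypothesis is Beaton's «T + L ≡ 1 (mod 2)»; on finite data the
identity fails for `H + W` even (lane y-table, a-p2/a-ref-1 2026-08-23). [cite: Beaton2014RotatedHoneycomb, Proposition 6 (arXiv:1210.0274v3 p. 9; parity T+L odd; n = 0 branch), proof pp. 9–10] -/
theorem rotStrip_identityY {H Wd : ℕ} (hH : 1 ≤ H) (hW : 1 ≤ Wd) (hodd : Odd (H + Wd)) {y : ℝ} (hy : 0 < y) :
    2 * Real.sin (3 * Real.pi / 16) * rotGFy ((rotStripV H Wd).erase wOut) H IsRotBotOut y +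
      2 * Real.sin (Real.pi / 16) * rotGFy ((rotStripV H Wd).erase wOut) H IsRotBotIn y +
      2 * Real.cos (3 * Real.pi / 16) * rotGFy ((rotStripV H Wd).erase wOut) H (IsRotLatDart H Wd) y +
      2 * (Real.cos (Real.pi / 16) -
          ((1 - hexCriticalFugacity * y - hexCriticalFugacity ^ 2 * y ^ 2) * Real.cos (17 * Real.pi / 16) +
              hexCriticalFugacity ^ 2 * y ^ 2 * Real.cos (5 * Real.pi / 16)) /
            (hexCriticalFugacity * y * (1 + hexCriticalFugacity * y))) *
        rotGFy ((rotStripV H Wd).erase wOut) H (IsRotTopDart H) y +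
      2 * Real.cos (7 * Real.pi / 16) * rotGFy ((rotStripV H Wd).erase wOut) H IsRotCloseDart y =
    2 * hexCriticalFugacity * Real.cos (Real.pi / 16) := by
  have hm := rotStrip_identityY_master hH hW hodd y
  have hB := rotGFy_top_eq_G1 hH hodd y
  have hc := beaton_coeff_eq y
  have hx : 0 < hexCriticalFugacity := hexCriticalFugacity_pos_lt_one.1
  have hden : hexCriticalFugacity * y * (1 + hexCriticalFugacity * y) ≠ 0 := by positivity
  -- the correction times `B` is `-(1-y)(cos(π/16) + x y cos(3π/16)) G¹`
  have hcorrB : ((1 - hexCriticalFugacity * y - hexCriticalFugacity ^ 2 * y ^ 2) * Real.cos (17 * Real.pi / 16) +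
        hexCriticalFugacity ^ 2 * y ^ 2 * Real.cos (5 * Real.pi / 16)) /
        (hexCriticalFugacity * y * (1 + hexCriticalFugacity * y)) *
      rotGFy ((rotStripV H Wd).erase wOut) H (IsRotTopDart H) y =
      -((1 - y) * (Real.cos (π / 16) + hexCriticalFugacity * y * Real.cos (3 * π / 16))) * rotG1 H Wd y := by
    rw [hB, hc]
    field_simp
  linear_combination hm - 2 * hcorrB

/-! ### Beaton's §4 shorthand: the `B`-coefficient `c_B(y)`, its root `y†`, and the finiteness of `B(x_c, y)` below `y†` -/

/-- **Beaton's shorthand for the `B`-coefficient**: for `y > 0`,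
`cos(π/16) - corr(y) = (cos(π/16) - x_c² y² cos(5π/16)) / (x_c y (1 + x_c y))`, i.e. (doubling)
`c_B(y) = c_B/(x_c y(1 + x_c y)) - x_c y c_A^O/(1 + x_c y)` with `c_B = 2cos(π/16)`, `c_A^O = 2cos(5π/16)`.
[cite: Beaton2014RotatedHoneycomb, §4 (arXiv v3 p. 16: the shorthand c_B(y), eq. (21))] -/
theorem rotB_coeff_eq {y : ℝ} (hy : 0 < y) :
    Real.cos (π / 16) -
        ((1 - hexCriticalFugacity * y - hexCriticalFugacity ^ 2 * y ^ 2) * Real.cos (17 * π / 16) +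
            hexCriticalFugacity ^ 2 * y ^ 2 * Real.cos (5 * π / 16)) /
          (hexCriticalFugacity * y * (1 + hexCriticalFugacity * y)) =
      (Real.cos (π / 16) - hexCriticalFugacity ^ 2 * y ^ 2 * Real.cos (5 * π / 16)) /
        (hexCriticalFugacity * y * (1 + hexCriticalFugacity * y)) := by
  obtain ⟨hK1, hT2, hT3, -, -, -⟩ := rot_trig_facts
  have hx : 0 < hexCriticalFugacity := hexCriticalFugacity_pos_lt_one.1
  have hden : hexCriticalFugacity * y * (1 + hexCriticalFugacity * y) ≠ 0 := by positivity
  rw [beaton_coeff_eq, eq_div_iff hden, sub_mul, div_mul_cancel₀ _ hden]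
  linear_combination (hexCriticalFugacity ^ 2 * y ^ 2) * hT2 + (hexCriticalFugacity * y) * hT3 +
    (y * Real.cos (π / 16) + hexCriticalFugacity * y ^ 2 * Real.cos (3 * π / 16)) * hK1

/-- **Beaton's `y†`** (the zero of `c_B(y)`): `y† = √(cos(π/16)/cos(5π/16)) / x_c` (`= √((2+√2)/(1+√2-√(2+√2))) = 2.455…`,
the critical surface fugacity of Theorem 1). [cite: Beaton2014RotatedHoneycomb, §4 (arXiv v3 p. 16: "c_B(y†) = 0 where y† = √((2+√2)/(1+√2-√(2+√2)))"), Theorem 1 (p. 2)] -/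
def rotYdagger : ℝ := Real.sqrt (Real.cos (π / 16) / Real.cos (5 * π / 16)) / hexCriticalFugacity

/-- `cos(π/16) > 0` and `cos(5π/16) > 0`. [folklore] -/
private theorem cos16_pos : 0 < Real.cos (π / 16) ∧ 0 < Real.cos (5 * π / 16) :=
  ⟨Real.cos_pos_of_mem_Ioo ⟨by linarith [Real.pi_pos], by linarith [Real.pi_pos]⟩,
    Real.cos_pos_of_mem_Ioo ⟨by linarith [Real.pi_pos], by linarith [Real.pi_pos]⟩⟩

/-- `y† > 0`. [cite: Beaton2014RotatedHoneycomb, §4 (y†)] -/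
theorem rotYdagger_pos : 0 < rotYdagger := by
  obtain ⟨c1, c5⟩ := cos16_pos
  exact div_pos (Real.sqrt_pos.2 (div_pos c1 c5)) hexCriticalFugacity_pos_lt_one.1

/-- `(x_c y†)² = cos(π/16)/cos(5π/16)`. [cite: Beaton2014RotatedHoneycomb, §4 (c_B(y†) = 0)] -/
theorem sq_hexCriticalFugacity_mul_rotYdagger :
    (hexCriticalFugacity * rotYdagger) ^ 2 = Real.cos (π / 16) / Real.cos (5 * π / 16) := by
  obtain ⟨c1, c5⟩ := cos16_pos
  have hx : 0 < hexCriticalFugacity := hexCriticalFugacity_pos_lt_one.1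
  rw [rotYdagger, mul_div_cancel₀ _ hx.ne', Real.sq_sqrt (div_pos c1 c5).le]

/-- **Sign of `c_B(y)`**: for `y > 0`, `cos(π/16) - x_c²y² cos(5π/16) > 0 ↔ y < y†`, and `= 0 ↔ y = y†` — "c_B(y) is a
continuous and monotone decreasing function of `y` for `y > 0`, and `c_B(y†) = 0`". [cite: Beaton2014RotatedHoneycomb, §4 (arXiv v3 p. 16)] -/
theorem rotB_coeff_pos_iff {y : ℝ} (hy : 0 < y) :
    (0 < Real.cos (π / 16) - hexCriticalFugacity ^ 2 * y ^ 2 * Real.cos (5 * π / 16) ↔ y < rotYdagger) ∧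
    (Real.cos (π / 16) - hexCriticalFugacity ^ 2 * y ^ 2 * Real.cos (5 * π / 16) = 0 ↔ y = rotYdagger) := by
  obtain ⟨c1, c5⟩ := cos16_pos
  have hx : 0 < hexCriticalFugacity := hexCriticalFugacity_pos_lt_one.1
  have hd := sq_hexCriticalFugacity_mul_rotYdagger
  have hyd := rotYdagger_pos
  set A := hexCriticalFugacity * rotYdagger with hA
  set B := hexCriticalFugacity * y with hB
  have hA0 : 0 < A := mul_pos hx hyd
  have hB0 : 0 < B := mul_pos hx hy
  -- compare `(x y)²` with `(x y†)² = cos(π/16)/cos(5π/16)`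
  have key : Real.cos (π / 16) - hexCriticalFugacity ^ 2 * y ^ 2 * Real.cos (5 * π / 16) =
      Real.cos (5 * π / 16) * (A ^ 2 - B ^ 2) := by
    rw [hd, mul_sub, mul_div_cancel₀ _ c5.ne', hB]; ring
  rw [key]
  have hiff : y < rotYdagger ↔ B < A := by
    rw [hA, hB]
    constructor
    · intro h; exact mul_lt_mul_of_pos_left h hx
    · intro h; nlinarith
  have hiff' : y = rotYdagger ↔ B = A := by
    rw [hA, hB]
    constructor
    · rintro rfl; rfl
    · intro h; exact mul_left_cancel₀ hx.ne' h
  rw [hiff, hiff']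
  constructor
  · rw [mul_pos_iff_of_pos_left c5, sub_pos]
    constructor
    · intro h; nlinarith
    · intro h; nlinarith
  · rw [mul_eq_zero, sub_eq_zero]
    constructor
    · rintro (h | h)
      · exact absurd h c5.ne'
      · nlinarith
    · intro h; right; rw [h]

/-- The weighted class generating functions are nonnegative for `y ≥ 0`. [cite: Beaton2014RotatedHoneycomb, §4 ("every term in (the identity) is non-negative")] -/
theorem rotGFy_nonneg (V : Finset HV) (H : ℕ) (cls : HV × HV → Prop) [DecidablePred cls] {y : ℝ} (hy : 0 ≤ y) :
    0 ≤ rotGFy V H cls y :=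
  sum_nonneg fun _ _ => mul_nonneg (pow_nonneg hexCriticalFugacity_pos_lt_one.1.le _) (pow_nonneg hy _)

/-- Class monotonicity in the domain for `y ≥ 0` (more walks, same weights). [cite: Beaton2014RotatedHoneycomb, §4 ("A^O_{T,L}, A^I_{T,L}, B_{T,L} and P_{T,L} are increasing with L")] -/
theorem rotGFy_mono {V V' : Finset HV} (h : V ⊆ V') (H : ℕ) (cls : HV × HV → Prop) [DecidablePred cls] {y : ℝ}
    (hy : 0 ≤ y) : rotGFy V H cls y ≤ rotGFy V' H cls y := by
  apply sum_le_sum_of_subset_of_nonneg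
  · intro P hP
    simp only [mem_filter] at hP ⊢
    exact ⟨mem_midWalks_iff.2 ((mem_midWalks_iff.1 hP.1).mono h), hP.2⟩
  · intro P _ _
    exact mul_nonneg (pow_nonneg hexCriticalFugacity_pos_lt_one.1.le _) (pow_nonneg hy _)

/-- **Finiteness of `B_{H,W}(x_c, y)` below `y†`, uniformly in the domain** (`H, W ≥ 1`, `H + W` odd): for `0 < y < y†`,
`B^{→}_{H,W}(x_c, y) ≤ x_c cos(π/16) · x_c y (1 + x_c y) / (cos(π/16) - x_c² y² cos(5π/16))` — all other terms of Prop. 6 are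
nonnegative and `c_B(y) > 0`.  This is the input of Beaton's Lemma 12 ("for `y < y†` the identity establishes the finiteness of
`B_T(x_c, y)`, and thus `y_T ≥ y†`"). [cite: Beaton2014RotatedHoneycomb, §4, Lemma 12 and its proof (arXiv v3 p. 17)] -/
theorem rotGFy_top_le_of_odd {H Wd : ℕ} (hH : 1 ≤ H) (hW : 1 ≤ Wd) (hodd : Odd (H + Wd)) {y : ℝ} (hy : 0 < y)
    (hlt : y < rotYdagger) :
    rotGFy ((rotStripV H Wd).erase wOut) H (IsRotTopDart H) y ≤
      hexCriticalFugacity * Real.cos (π / 16) * (hexCriticalFugacity * y * (1 + hexCriticalFugacity * y)) /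
        (Real.cos (π / 16) - hexCriticalFugacity ^ 2 * y ^ 2 * Real.cos (5 * π / 16)) := by
  have hid := rotStrip_identityY hH hW hodd hy
  rw [rotB_coeff_eq hy] at hid
  have hκ : 0 < Real.cos (π / 16) - hexCriticalFugacity ^ 2 * y ^ 2 * Real.cos (5 * π / 16) :=
    (rotB_coeff_pos_iff hy).1.2 hlt
  have hx : 0 < hexCriticalFugacity := hexCriticalFugacity_pos_lt_one.1
  have hden : 0 < hexCriticalFugacity * y * (1 + hexCriticalFugacity * y) := by positivity
  set V := (rotStripV H Wd).erase wOut
  set κ := (Real.cos (π / 16) - hexCriticalFugacity ^ 2 * y ^ 2 * Real.cos (5 * π / 16)) /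
      (hexCriticalFugacity * y * (1 + hexCriticalFugacity * y)) with hκdef
  have hκ0 : 0 < κ := div_pos hκ hden
  have s1 : 0 ≤ Real.sin (Real.pi / 16) := Real.sin_nonneg_of_nonneg_of_le_pi (by positivity) (by linarith [Real.pi_pos])
  have s3 : 0 ≤ Real.sin (3 * Real.pi / 16) := Real.sin_nonneg_of_nonneg_of_le_pi (by positivity) (by linarith [Real.pi_pos])
  have c3 : 0 ≤ Real.cos (3 * Real.pi / 16) := Real.cos_nonneg_of_mem_Icc ⟨by linarith [Real.pi_pos], by linarith [Real.pi_pos]⟩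
  have c7 : 0 ≤ Real.cos (7 * Real.pi / 16) := Real.cos_nonneg_of_mem_Icc ⟨by linarith [Real.pi_pos], by linarith [Real.pi_pos]⟩
  have hB : κ * rotGFy V H (IsRotTopDart H) y ≤ hexCriticalFugacity * Real.cos (π / 16) := by
    nlinarith [mul_nonneg s3 (rotGFy_nonneg V H IsRotBotOut hy.le), mul_nonneg s1 (rotGFy_nonneg V H IsRotBotIn hy.le),
      mul_nonneg c3 (rotGFy_nonneg V H (IsRotLatDart H Wd) hy.le), mul_nonneg c7 (rotGFy_nonneg V H IsRotCloseDart hy.le)]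
  rw [le_div_iff₀ hκ]
  have := mul_le_mul_of_nonneg_right hB hden.le
  calc rotGFy V H (IsRotTopDart H) y * (Real.cos (π / 16) - hexCriticalFugacity ^ 2 * y ^ 2 * Real.cos (5 * π / 16))
      = κ * rotGFy V H (IsRotTopDart H) y * (hexCriticalFugacity * y * (1 + hexCriticalFugacity * y)) := by
        rw [hκdef]; field_simp
    _ ≤ hexCriticalFugacity * Real.cos (π / 16) * (hexCriticalFugacity * y * (1 + hexCriticalFugacity * y)) := this

/-- **Finiteness of `B_{H,W}(x_c, y)` below `y†` for EVERY width** (the parity restriction is lifted by the monotonicity of `B` in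
the width — Beaton: "A^O, A^I, B and P actually increase with L regardless of whether T + L ≡ 1 (mod 2) or not").
[cite: Beaton2014RotatedHoneycomb, §4 (arXiv v3 p. 16) and Lemma 12 (p. 17)] -/
theorem rotGFy_top_le {H : ℕ} (hH : 1 ≤ H) {y : ℝ} (hy : 0 < y) (hlt : y < rotYdagger) (Wd : ℕ) :
    rotGFy ((rotStripV H Wd).erase wOut) H (IsRotTopDart H) y ≤
      hexCriticalFugacity * Real.cos (π / 16) * (hexCriticalFugacity * y * (1 + hexCriticalFugacity * y)) /
        (Real.cos (π / 16) - hexCriticalFugacity ^ 2 * y ^ 2 * Real.cos (5 * π / 16)) := by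
  -- a wider domain of the right parity
  obtain ⟨W', hW', hle, hodd⟩ : ∃ W', 1 ≤ W' ∧ Wd ≤ W' ∧ Odd (H + W') := by
    rcases Nat.even_or_odd (H + Wd) with h | h
    · exact ⟨Wd + 1, by omega, by omega, by rw [← add_assoc]; exact h.add_one⟩
    · exact ⟨Wd + 2, by omega, by omega, by
        rw [show H + (Wd + 2) = (H + Wd) + 2 by ring]; exact h.add_even (by norm_num)⟩
  exact (rotGFy_mono (erase_subset_erase _ (rotStripV_mono_width hle)) H (IsRotTopDart H) hy.le).trans
    (rotGFy_top_le_of_odd hH hW' hodd hy hlt)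

/-- **`y†` as printed**: `y† = √((2 + √2)/(1 + √2 - √(2 + √2)))` (`= 2.455…`) — from `cos(5π/16) = (1 + √2 - √(2+√2)) cos(π/16)`
(the sum-to-product identities at `π/8`) and `x_c = 1/√(2+√2)`. [cite: Beaton2014RotatedHoneycomb, §4 (arXiv v3 p. 16: y† = √((2+√2)/(1+√2-√(2+√2)))), Theorem 1 (p. 2: y_c = 2.455…)] -/
theorem rotYdagger_eq_printed :
    rotYdagger = Real.sqrt ((2 + Real.sqrt 2) / (1 + Real.sqrt 2 - Real.sqrt (2 + Real.sqrt 2))) := by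
  obtain ⟨-, hT2, hT3, -, -, -⟩ := rot_trig_facts
  obtain ⟨c1, c5⟩ := cos16_pos
  set u := Real.sqrt (2 + Real.sqrt 2) with hu
  have hu0 : 0 < u := Real.sqrt_pos.2 (by positivity)
  have hu2 : u ^ 2 = 2 + Real.sqrt 2 := Real.sq_sqrt (by positivity)
  have h8 : Real.cos (π / 8) = u / 2 := by rw [Real.cos_pi_div_eight]
  -- `cos(5π/16) = (1 + √2 - u) cos(π/16)`
  have h5 : Real.cos (5 * π / 16) = (1 + Real.sqrt 2 - u) * Real.cos (π / 16) := by
    rw [h8] at hT2 hT3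
    have h3 : Real.cos (3 * π / 16) = (u - 1) * Real.cos (π / 16) := by linarith
    rw [h3] at hT2
    nlinarith [hu2]
  have hden : 0 < 1 + Real.sqrt 2 - u := by
    have := div_pos c5 c1
    rw [h5, mul_div_cancel_right₀ _ c1.ne'] at this
    exact this
  have hx : hexCriticalFugacity = u⁻¹ := rfl
  have hfrac : Real.cos (π / 16) / ((1 + Real.sqrt 2 - u) * Real.cos (π / 16)) = 1 / (1 + Real.sqrt 2 - u) := by
    field_simp
  rw [rotYdagger, hx, h5, hfrac, div_inv_eq_mul, ← hu2,
    show u ^ 2 / (1 + Real.sqrt 2 - u) = u ^ 2 * (1 / (1 + Real.sqrt 2 - u)) by ring,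
    Real.sqrt_mul' _ (by positivity : (0 : ℝ) ≤ 1 / (1 + Real.sqrt 2 - u)), Real.sqrt_sq hu0.le, mul_comm]

section Limit

open Filter Topology

/-- `W ↦ B^{→}_{H,W}(x_c, y)` is monotone for `y ≥ 0`. [cite: Beaton2014RotatedHoneycomb, §4 ("B_{T,L} … increasing with L")] -/
theorem rotGFy_top_monotone (H : ℕ) {y : ℝ} (hy : 0 ≤ y) :
    Monotone (fun Wd : ℕ => rotGFy ((rotStripV H Wd).erase wOut) H (IsRotTopDart H) y) :=
  fun _ _ h => rotGFy_mono (erase_subset_erase _ (rotStripV_mono_width h)) H (IsRotTopDart H) hy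

/-- **`B_T(x_c, y) := lim_{W → ∞} B^{→}_{H,W}(x_c, y)` exists and is finite for `0 < y < y†`** (`H ≥ 1`), with the bound of
`rotGFy_top_le` — "for `y < y†` the identity establishes the finiteness of `B_T(x_c, y)`", the heart of Beaton's Lemma 12
(`y_T ≥ y†`, hence `y_c ≥ y†`). [cite: Beaton2014RotatedHoneycomb, §4, Lemma 12 and its proof (arXiv v3 p. 17); eq. (22) (the limit identity, p. 16)] -/
theorem rotGFy_top_tendsto {H : ℕ} (hH : 1 ≤ H) {y : ℝ} (hy : 0 < y) (hlt : y < rotYdagger) :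
    ∃ B : ℝ, B ≤ hexCriticalFugacity * Real.cos (π / 16) * (hexCriticalFugacity * y * (1 + hexCriticalFugacity * y)) /
        (Real.cos (π / 16) - hexCriticalFugacity ^ 2 * y ^ 2 * Real.cos (5 * π / 16)) ∧
      (∀ Wd : ℕ, rotGFy ((rotStripV H Wd).erase wOut) H (IsRotTopDart H) y ≤ B) ∧
      Tendsto (fun Wd : ℕ => rotGFy ((rotStripV H Wd).erase wOut) H (IsRotTopDart H) y) atTop (𝓝 B) := by
  have hbdd : BddAbove (Set.range fun Wd : ℕ => rotGFy ((rotStripV H Wd).erase wOut) H (IsRotTopDart H) y) :=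
    ⟨_, by rintro _ ⟨Wd, rfl⟩; exact rotGFy_top_le hH hy hlt Wd⟩
  exact ⟨⨆ Wd : ℕ, rotGFy ((rotStripV H Wd).erase wOut) H (IsRotTopDart H) y,
    ciSup_le fun Wd => rotGFy_top_le hH hy hlt Wd, fun Wd => le_ciSup hbdd Wd,
    tendsto_atTop_ciSup (rotGFy_top_monotone H hy.le) hbdd⟩

end Limit

end HV

end Literature.Probability.RandomPlanarGeometry.SAW
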